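/-
Copyright (c) 2026. All rights reserved.
Released under Apache 2.0 license as described in the file LICENSE.
-/
import Literature.Geometry.Kaehler.ComplexTorusQuaternionXSixKRYDegreeFormulaComputable
import Literature.Geometry.Kaehler.ComplexTorusQuaternionXSixAtkinLehnerQuotientsSpecialPoints
import Literature.Geometry.Kaehler.ComplexTorusQuaternionXSixSpecialCyclesPointCount
import HarnessLib

/-!
# The number of points of the special cycle `Z(t)` on `X₆`, on the Atkin–Lehner quotients `X₆^{(2)}, X₆^{(3)}, X₆^{(6)}`
# and on `X₆⁺ = X₆/W`, IN CLOSED FORM FOR EVERY `t > 0`: `#(Pt(t)/Γ₆) = δ(d)·Σ_{c ∣ F, (c,6)=1} h(c²d)`,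
# `2·#(Pt(t)/Γ₆^{(m)}) = δΣh + 2·[t ∈ t_m·□]`, `4·#(Pt(t)/Γ₆⁺) = 4·|L(t)/N(O₆)| = δΣh + 2·[t ∈ □ ∪ 3□ ∪ 6□]`

[tag: complex_torus] [tag: abelian_surface] [tag: quaternion_multiplication] [tag: complex_multiplication]
[tag: shimura_curve] [tag: special_cycles] [tag: atkin_lehner] [tag: cm_points]

Lane `lit-hodgefound`, seat p12, row g41-#1 — THEOREMS ONLY (no definition, no named fact, no instance). The assembly of
three finished strands of the `X₆` series, which until now met only in tables of sample values:

* the orbit counts of the Atkin–Lehner group `W ≅ (ℤ/2ℤ)²` on the points of `Z(t)` (`…XSixSpecialPointsBurnside`: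
  Burnside with the fixed classes of `ω₂, ω₃, ω₆` = the points of `Z(1), Z(3), Z(6)` under `Z(t)`, i.e. `t ∈ □, 3□, 6□`;
  `…XSixAtkinLehnerQuotientsSpecialPoints`: the three double covers `X₆ → X₆^{(m)}`; `…XSixPlusSpecialPointsCount`:
  `#(Pt(t)/Γ₆⁺) = |L(t)/N(O₆)|`), stated there as FOUR separate cases (`t = m²`, `3m²`, `6m²`, generic);
* the dictionary `#(Pt(t)/Γ₆) = |L(t)/O₆^×|` (`…XSixSpecialCyclesPointCount`, KRY (3.4.13));
* Eichler's class-number formula `|L(t)/O₆^×| = (1 − χ₈(d))(1 − (d∕3))·Σ_{c ∣ F, (c,6)=1} h(c²d)`, `d = −4t/F²`,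
  `F = conductor 0 t` (`…XSixEichlerClassNumberFormula`, computable form `…XSixKRYDegreeFormulaComputable`).

Writing `δΣh(t)` for the right-hand side of Eichler's formula and `ε(t) = 2` if `t` is a square, three times a square or
six times a square, `ε(t) = 0` otherwise (the three cases are mutually exclusive), the file proves, for EVERY `t > 0`:

* §1 (uniform Burnside, one statement per quotient, `t : ℤ`): **`#(Pt(t)/Γ₆) + ε(t) = 4·#(Pt(t)/Γ₆⁺)`**,
  **`|L(t)/O₆^×| + ε(t) = 4·|L(t)/N(O₆)|`** (`card_specialPoints_add_ite_eq_four_mul_card_specialPointsPlus`,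
  `card_unit_classes_add_ite_eq_four_mul_card_normaliser_classes`), and for `m = 2, 3, 6` with `t₂ = 1, t₃ = 3, t₆ = 6`:
  **`#(Pt(t)/Γ₆) + 2·[t ∈ t_m□] = 2·#(Pt(t)/Γ₆^{(m)})`** (`card_specialPoints_add_ite_eq_two_mul_card_atkinLehnerQuotient{Two,Three,Six}`).
* §2 (closed forms, `t : ℕ`): **`#(Pt(t)/Γ₆) = δΣh(t)`** (`card_specialPoints_eq_kronecker`), **`|L(t)/Γ₆| = 2·δΣh(t)`**
  (`card_normOne_classes_eq_kronecker`), **`2·#(Pt(t)/Γ₆^{(m)}) = δΣh(t) + 2·[t ∈ t_m□]`**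
  (`two_mul_card_atkinLehnerQuotient{Two,Three,Six}_eq_kronecker`), **`4·#(Pt(t)/Γ₆⁺) = δΣh(t) + ε(t)`**
  (`four_mul_card_specialPointsPlus_eq_kronecker`) and **`4·|L(t)/N(O₆)| = δΣh(t) + ε(t)`**
  (`four_mul_card_normaliser_classes_eq_kronecker`) — the number of `W`-invariant special cycles of index `t`
  (KRY Remark 3.4.7) in closed form.
* §3 (arithmetic shadow): **`4 ∣ δΣh(t) + ε(t)`** and **`2 ∣ δΣh(t)`** for every `t > 0`
  (`four_dvd_kronecker_add_ite`, `two_dvd_kronecker`) — congruences for the class-number expression obtained from the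
  free `W`-action, with **`|L(t)/O₆^×| ≡ ε(t) (mod 4)`** (`card_unit_classes_emod_four`).
* §4 (values by kernel evaluation of the proved formulas): `|L(t)/N(O₆)| = #(Pt(t)/Γ₆⁺) = 1, 1, 1, 2, 1` for
  `t = 30, 43, 67, 100, 163` (`Z(67)`, `Z(163)`: four points on `X₆`, ONE on `X₆⁺`; `Z(100) ⊃ 10·Z(1)`: six points on
  `X₆`, two on `X₆⁺`), extending the ten-value table `1,1,1,1,1,1,1,1,2,2` of `…NormaliserClassCount` (obtained there by
  exhaustion over `L(t)`).

## The print

* S. Kudla, M. Rapoport, T. Yang, *Modular Forms and Special Cycles on Shimura Curves* (2006), §3.4: (3.4.4)–(3.4.6)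
  «`deg Z(t)_ℚ = 2δ(d;D(B))H₀(t;D(B))`», (3.4.13) «`Z(t)(ℂ) = Σ_{x ∈ L(t) mod Γ} pr(D_x)`», Remark 3.4.7 p. 57 «the group
  of Atkin-Lehner involutions permutes the components transitively … we consider only cycles which are invariant under the
  group of Atkin-Lehner involutions», Prop. 3.4.5. [cite: KudlaRapoportYang2006, §3.4 (3.4.4)–(3.4.6), (3.4.13), Remark 3.4.7]
* A. P. Ogg, *Real points on Shimura curves* (1983), §2 pp. 283–284, (2)–(4): `W ≅ C₂^r`; the fixed points of `w(m)`
  («`μ² = −m`», «`ε = 1 + ζ₄` if `m = 2`, `ε = 1 − ζ₃` if `m = 3`»); `g^{(m)} = (g + 1)/2 − e(m)/4`. [cite: Ogg1983RealPoints, §2 (2)–(4)]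
* P. Bayer, A. Travesa (2007), §2 p. 318 («`X₆^{(2)} = X₆/⟨ω₂⟩, X₆^{(3)} = X₆/⟨ω₃⟩, X₆^{(6)} = X₆/⟨ω₆⟩` and `X₆⁺ = X₆/W`»),
  §7 and Table 9. [cite: BayerTravesa2007, §2 p. 318 and §7]
* M. Eichler (1955), Satz 5; M.-F. Vignéras, LNM 800 (1980), Ch. III §5 Cor. 5.12–5.14 (the class-number formula for
  optimal embeddings). [cite: Eichler1955, Satz 5] [cite: VignerasLNM800, Ch. III §5 Cor. 5.12–5.14]

## Scope (honest)

Assembly row: every count is transported from the cited tree files; the new content is the uniform `ε(t)`-form valid for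
all `t`, the substitution of Eichler's closed form into the five quotient counts, the resulting class-number congruences,
and new sample values. The quotient TYPES are the bare `Quot`s of the series; `X₆^{(m)}`, `X₆⁺` as curves, genera and
Riemann–Hurwitz are not touched. The indicator `ε(t)` is an inline `if` over `∃ k, t = k²` etc. (classical decidability).
0 definitions, 0 named facts, 0 instances — net debt `0`.
-/

set_option maxSynthPendingDepth 3

open Quaternion Function
open scoped Pointwise
open Literature.NumberTheory.Automorphic Literature.NumberTheory.Automorphic.Brandt
open Literature.NumberTheory.Automorphic.HeckeTraceFormulaGL2Level (ellipticConductors)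
open Literature.NumberTheory.QuadraticFields.Quadratic (BinQF.classNumber)

namespace Literature.Geometry.Kaehler.ComplexTorus.QuaternionType

/-! ## §1 Burnside with the indicator `ε(t)`: one statement for every `t > 0` -/

section Uniform

open scoped Classical in
/-- **`#(Pt(t)/Γ₆) + ε(t) = 4·#(Pt(t)/Γ₆⁺)` for every `t > 0`**, `ε(t) = 2` if `t ∈ □ ∪ 3□ ∪ 6□` else `0`: Burnside for the
Atkin–Lehner group `W ≅ (ℤ/2ℤ)²` on the points of `Z(t)`, whose only fixed classes are the two `Z(1)`-points (under `ω₂`,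
`t` a square), the two `Z(3)`-points (`ω₃`, `t ∈ 3□`) or the two `Z(6)`-points (`ω₆`, `t ∈ 6□`).
[cite: KudlaRapoportYang2006, §3.4 Remark 3.4.7] [cite: Ogg1983RealPoints, §2 (2)–(4)] [cite: BayerTravesa2007, §2 p. 318 and §7] -/
theorem card_specialPoints_add_ite_eq_four_mul_card_specialPointsPlus {t : ℤ} (ht : 0 < t) :
    Nat.card (Quot (fun p q : {τ : ℂ // 0 < τ.im ∧ ∃ x : ℍ[ℚ,((-1 : ℤ) : ℚ),((3 : ℤ) : ℚ)],
        x ∈ order (-1) 3 ∧ x.re = 0 ∧ (x * star x).re = t ∧ moebius (rho (-1) 3 (by norm_num) (castQ (-1) 3 x)) τ = τ} ↦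
      ∃ v : ℍ[ℚ,((-1 : ℤ) : ℚ),((3 : ℤ) : ℚ)], (v ∈ order (-1) 3 ∨ v - ⟨1/2, 1/2, 1/2, -1/2⟩ ∈ order (-1) 3) ∧
        v * star v = 1 ∧ moebius (rho (-1) 3 (by norm_num) (castQ (-1) 3 v)) p.1 = q.1)) + (if ((∃ k : ℤ, t = k ^ 2) ∨ (∃ k : ℤ, t = 3 * k ^ 2) ∨ (∃ k : ℤ, t = 6 * k ^ 2)) then 2 else 0) = 4 * Nat.card (Quot (fun p q : {τ : ℂ // 0 < τ.im ∧ ∃ x : ℍ[ℚ,((-1 : ℤ) : ℚ),((3 : ℤ) : ℚ)],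
        x ∈ order (-1) 3 ∧ x.re = 0 ∧ (x * star x).re = t ∧ moebius (rho (-1) 3 (by norm_num) (castQ (-1) 3 x)) τ = τ} ↦
      ∃ g : ℍ[ℚ,((-1 : ℤ) : ℚ),((3 : ℤ) : ℚ)], g ≠ 0 ∧
        (∀ a : ℍ[ℚ,((-1 : ℤ) : ℚ),((3 : ℤ) : ℚ)], (a ∈ order (-1) 3 ∨ a - ⟨1/2, 1/2, 1/2, -1/2⟩ ∈ order (-1) 3) →
          ∃ b : ℍ[ℚ,((-1 : ℤ) : ℚ),((3 : ℤ) : ℚ)], (b ∈ order (-1) 3 ∨ b - ⟨1/2, 1/2, 1/2, -1/2⟩ ∈ order (-1) 3) ∧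
            g * a = b * g) ∧
        0 < (g * star g).re ∧ moebius (rho (-1) 3 (by norm_num) (castQ (-1) 3 g)) p.1 = q.1)) := by
  by_cases h : ((∃ k : ℤ, t = k ^ 2) ∨ (∃ k : ℤ, t = 3 * k ^ 2) ∨ (∃ k : ℤ, t = 6 * k ^ 2))
  · rw [if_pos h]
    rcases h with ⟨k, hk⟩ | ⟨k, hk⟩ | ⟨k, hk⟩
    · exact (card_specialPoints_add_two_eq_four_mul_card_specialPointsPlus_of_sq ht hk).1
    · exact (card_specialPoints_add_two_eq_four_mul_card_specialPointsPlus_of_three_mul_sq ht hk).1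
    · exact (card_specialPoints_add_two_eq_four_mul_card_specialPointsPlus_of_six_mul_sq ht hk).1
  · rw [if_neg h, add_zero]
    simp only [not_or] at h
    exact (card_specialPoints_eq_four_mul_card_specialPointsPlus_of_generic ht h.1 h.2.1 h.2.2).1

open scoped Classical in
/-- **`|L(t)/O₆^×| + ε(t) = 4·|L(t)/N(O₆)|` for every `t > 0`** — the vector form: `W` acts on Kudla–Rapoport–Yang's index
set `L(t)/O₆^×` with orbit set `L(t)/N(O₆)`, freely unless `t ∈ □ ∪ 3□ ∪ 6□`, where exactly one involution fixes exactly
two classes. This is `card_unit_classes_eq_four_mul_card_normaliser_classes` of `…NormaliserClassCount` (`t ≡ 19 (mod 24)`)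
for ALL `t`. [cite: KudlaRapoportYang2006, §3.4 Remark 3.4.7 and (3.4.13)] [cite: VignerasLNM800, Ch. IV §3 B] [cite: Ogg1983RealPoints, §2 (2)–(4)] -/
theorem card_unit_classes_add_ite_eq_four_mul_card_normaliser_classes {t : ℤ} (ht : 0 < t) :
    Nat.card (Quot (fun x y : {x : ℤ × ℤ × ℤ // x.1 ^ 2 - 3 * x.2.1 ^ 2 - 3 * x.2.2 ^ 2 = t} ↦
      ∃ v : ℍ[ℚ,((-1 : ℤ) : ℚ),((3 : ℤ) : ℚ)], (v ∈ order (-1) 3 ∨ v - ⟨1/2, 1/2, 1/2, -1/2⟩ ∈ order (-1) 3) ∧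
        ((v * star v).re = 1 ∨ (v * star v).re = -1) ∧
        v * ⟨0, x.1.1, x.1.2.1, x.1.2.2⟩ = ⟨0, y.1.1, y.1.2.1, y.1.2.2⟩ * v)) + (if ((∃ k : ℤ, t = k ^ 2) ∨ (∃ k : ℤ, t = 3 * k ^ 2) ∨ (∃ k : ℤ, t = 6 * k ^ 2)) then 2 else 0) = 4 * Nat.card (Quot (fun x y : {x : ℤ × ℤ × ℤ // x.1 ^ 2 - 3 * x.2.1 ^ 2 - 3 * x.2.2 ^ 2 = t} ↦
      ∃ g : ℍ[ℚ,((-1 : ℤ) : ℚ),((3 : ℤ) : ℚ)], g ≠ 0 ∧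
        (∀ a : ℍ[ℚ,((-1 : ℤ) : ℚ),((3 : ℤ) : ℚ)], (a ∈ order (-1) 3 ∨ a - ⟨1/2, 1/2, 1/2, -1/2⟩ ∈ order (-1) 3) →
          ∃ b : ℍ[ℚ,((-1 : ℤ) : ℚ),((3 : ℤ) : ℚ)], (b ∈ order (-1) 3 ∨ b - ⟨1/2, 1/2, 1/2, -1/2⟩ ∈ order (-1) 3) ∧
            g * a = b * g) ∧
        g * ⟨0, x.1.1, x.1.2.1, x.1.2.2⟩ = ⟨0, y.1.1, y.1.2.1, y.1.2.2⟩ * g)) := by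
  by_cases h : ((∃ k : ℤ, t = k ^ 2) ∨ (∃ k : ℤ, t = 3 * k ^ 2) ∨ (∃ k : ℤ, t = 6 * k ^ 2))
  · rw [if_pos h]
    rcases h with ⟨k, hk⟩ | ⟨k, hk⟩ | ⟨k, hk⟩
    · exact (card_specialPoints_add_two_eq_four_mul_card_specialPointsPlus_of_sq ht hk).2
    · exact (card_specialPoints_add_two_eq_four_mul_card_specialPointsPlus_of_three_mul_sq ht hk).2
    · exact (card_specialPoints_add_two_eq_four_mul_card_specialPointsPlus_of_six_mul_sq ht hk).2
  · rw [if_neg h, add_zero]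
    simp only [not_or] at h
    exact (card_specialPoints_eq_four_mul_card_specialPointsPlus_of_generic ht h.1 h.2.1 h.2.2).2

open scoped Classical in
/-- **`#(Pt(t)/Γ₆) + 2·[t ∈ □] = 2·#(Pt(t)/Γ₆^{(2)})` for every `t > 0`**: the double cover `X₆ → X₆^{(2)} = X₆/ω₂` restricted
to `Z(t)` is ramified exactly at the two `Z(1)`-points, present iff `t` is a square.
[cite: BayerTravesa2007, §2 p. 318 and §7] [cite: Ogg1983RealPoints, §2 (3)–(4)] [cite: KudlaRapoportYang2006, §3.4 Remark 3.4.7] -/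
theorem card_specialPoints_add_ite_eq_two_mul_card_atkinLehnerQuotientTwo {t : ℤ} (ht : 0 < t) :
    Nat.card (Quot (fun p q : {τ : ℂ // 0 < τ.im ∧ ∃ x : ℍ[ℚ,((-1 : ℤ) : ℚ),((3 : ℤ) : ℚ)],
        x ∈ order (-1) 3 ∧ x.re = 0 ∧ (x * star x).re = t ∧ moebius (rho (-1) 3 (by norm_num) (castQ (-1) 3 x)) τ = τ} ↦
      ∃ v : ℍ[ℚ,((-1 : ℤ) : ℚ),((3 : ℤ) : ℚ)], (v ∈ order (-1) 3 ∨ v - ⟨1/2, 1/2, 1/2, -1/2⟩ ∈ order (-1) 3) ∧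
        v * star v = 1 ∧ moebius (rho (-1) 3 (by norm_num) (castQ (-1) 3 v)) p.1 = q.1)) + (if (∃ k : ℤ, t = k ^ 2) then 2 else 0) = 2 * Nat.card (Quot (fun p q : {τ : ℂ // 0 < τ.im ∧ ∃ x : ℍ[ℚ,((-1 : ℤ) : ℚ),((3 : ℤ) : ℚ)],
        x ∈ order (-1) 3 ∧ x.re = 0 ∧ (x * star x).re = t ∧ moebius (rho (-1) 3 (by norm_num) (castQ (-1) 3 x)) τ = τ} ↦
      ∃ g : ℍ[ℚ,((-1 : ℤ) : ℚ),((3 : ℤ) : ℚ)], g ≠ 0 ∧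
        (∀ a : ℍ[ℚ,((-1 : ℤ) : ℚ),((3 : ℤ) : ℚ)], (a ∈ order (-1) 3 ∨ a - ⟨1/2, 1/2, 1/2, -1/2⟩ ∈ order (-1) 3) →
          ∃ b : ℍ[ℚ,((-1 : ℤ) : ℚ),((3 : ℤ) : ℚ)], (b ∈ order (-1) 3 ∨ b - ⟨1/2, 1/2, 1/2, -1/2⟩ ∈ order (-1) 3) ∧
            g * a = b * g) ∧
        0 < (g * star g).re ∧ (∃ s : ℚ, (g * star g).re = s ^ 2 ∨ (g * star g).re = 2 * s ^ 2) ∧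
        moebius (rho (-1) 3 (by norm_num) (castQ (-1) 3 g)) p.1 = q.1)) := by
  by_cases h : (∃ k : ℤ, t = k ^ 2)
  · rw [if_pos h]
    obtain ⟨k, hk⟩ := h
    exact card_specialPoints_add_two_eq_two_mul_card_atkinLehnerQuotientTwo_of_sq_mul ht hk
  · rw [if_neg h, add_zero]
    exact card_specialPoints_eq_two_mul_card_atkinLehnerQuotientTwo_of_not ht h

open scoped Classical in
/-- **`#(Pt(t)/Γ₆) + 2·[t ∈ 3□] = 2·#(Pt(t)/Γ₆^{(3)})` for every `t > 0`** (ramified exactly at the two `Z(3)`-points).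
[cite: BayerTravesa2007, §2 p. 318 and §7] [cite: Ogg1983RealPoints, §2 (3)–(4)] [cite: KudlaRapoportYang2006, §3.4 Remark 3.4.7] -/
theorem card_specialPoints_add_ite_eq_two_mul_card_atkinLehnerQuotientThree {t : ℤ} (ht : 0 < t) :
    Nat.card (Quot (fun p q : {τ : ℂ // 0 < τ.im ∧ ∃ x : ℍ[ℚ,((-1 : ℤ) : ℚ),((3 : ℤ) : ℚ)],
        x ∈ order (-1) 3 ∧ x.re = 0 ∧ (x * star x).re = t ∧ moebius (rho (-1) 3 (by norm_num) (castQ (-1) 3 x)) τ = τ} ↦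
      ∃ v : ℍ[ℚ,((-1 : ℤ) : ℚ),((3 : ℤ) : ℚ)], (v ∈ order (-1) 3 ∨ v - ⟨1/2, 1/2, 1/2, -1/2⟩ ∈ order (-1) 3) ∧
        v * star v = 1 ∧ moebius (rho (-1) 3 (by norm_num) (castQ (-1) 3 v)) p.1 = q.1)) + (if (∃ k : ℤ, t = 3 * k ^ 2) then 2 else 0) = 2 * Nat.card (Quot (fun p q : {τ : ℂ // 0 < τ.im ∧ ∃ x : ℍ[ℚ,((-1 : ℤ) : ℚ),((3 : ℤ) : ℚ)],
        x ∈ order (-1) 3 ∧ x.re = 0 ∧ (x * star x).re = t ∧ moebius (rho (-1) 3 (by norm_num) (castQ (-1) 3 x)) τ = τ} ↦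
      ∃ g : ℍ[ℚ,((-1 : ℤ) : ℚ),((3 : ℤ) : ℚ)], g ≠ 0 ∧
        (∀ a : ℍ[ℚ,((-1 : ℤ) : ℚ),((3 : ℤ) : ℚ)], (a ∈ order (-1) 3 ∨ a - ⟨1/2, 1/2, 1/2, -1/2⟩ ∈ order (-1) 3) →
          ∃ b : ℍ[ℚ,((-1 : ℤ) : ℚ),((3 : ℤ) : ℚ)], (b ∈ order (-1) 3 ∨ b - ⟨1/2, 1/2, 1/2, -1/2⟩ ∈ order (-1) 3) ∧
            g * a = b * g) ∧
        0 < (g * star g).re ∧ (∃ s : ℚ, (g * star g).re = s ^ 2 ∨ (g * star g).re = 3 * s ^ 2) ∧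
        moebius (rho (-1) 3 (by norm_num) (castQ (-1) 3 g)) p.1 = q.1)) := by
  by_cases h : (∃ k : ℤ, t = 3 * k ^ 2)
  · rw [if_pos h]
    obtain ⟨k, hk⟩ := h
    exact card_specialPoints_add_two_eq_two_mul_card_atkinLehnerQuotientThree_of_sq_mul ht hk
  · rw [if_neg h, add_zero]
    exact card_specialPoints_eq_two_mul_card_atkinLehnerQuotientThree_of_not ht h

open scoped Classical in
/-- **`#(Pt(t)/Γ₆) + 2·[t ∈ 6□] = 2·#(Pt(t)/Γ₆^{(6)})` for every `t > 0`** (ramified exactly at the two `Z(6)`-points, the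
SCM points `P₀, P₇`). [cite: BayerTravesa2007, §2 p. 318 and §7] [cite: Ogg1983RealPoints, §2 (3)–(4)] [cite: KudlaRapoportYang2006, §3.4 Remark 3.4.7] -/
theorem card_specialPoints_add_ite_eq_two_mul_card_atkinLehnerQuotientSix {t : ℤ} (ht : 0 < t) :
    Nat.card (Quot (fun p q : {τ : ℂ // 0 < τ.im ∧ ∃ x : ℍ[ℚ,((-1 : ℤ) : ℚ),((3 : ℤ) : ℚ)],
        x ∈ order (-1) 3 ∧ x.re = 0 ∧ (x * star x).re = t ∧ moebius (rho (-1) 3 (by norm_num) (castQ (-1) 3 x)) τ = τ} ↦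
      ∃ v : ℍ[ℚ,((-1 : ℤ) : ℚ),((3 : ℤ) : ℚ)], (v ∈ order (-1) 3 ∨ v - ⟨1/2, 1/2, 1/2, -1/2⟩ ∈ order (-1) 3) ∧
        v * star v = 1 ∧ moebius (rho (-1) 3 (by norm_num) (castQ (-1) 3 v)) p.1 = q.1)) + (if (∃ k : ℤ, t = 6 * k ^ 2) then 2 else 0) = 2 * Nat.card (Quot (fun p q : {τ : ℂ // 0 < τ.im ∧ ∃ x : ℍ[ℚ,((-1 : ℤ) : ℚ),((3 : ℤ) : ℚ)],
        x ∈ order (-1) 3 ∧ x.re = 0 ∧ (x * star x).re = t ∧ moebius (rho (-1) 3 (by norm_num) (castQ (-1) 3 x)) τ = τ} ↦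
      ∃ g : ℍ[ℚ,((-1 : ℤ) : ℚ),((3 : ℤ) : ℚ)], g ≠ 0 ∧
        (∀ a : ℍ[ℚ,((-1 : ℤ) : ℚ),((3 : ℤ) : ℚ)], (a ∈ order (-1) 3 ∨ a - ⟨1/2, 1/2, 1/2, -1/2⟩ ∈ order (-1) 3) →
          ∃ b : ℍ[ℚ,((-1 : ℤ) : ℚ),((3 : ℤ) : ℚ)], (b ∈ order (-1) 3 ∨ b - ⟨1/2, 1/2, 1/2, -1/2⟩ ∈ order (-1) 3) ∧
            g * a = b * g) ∧
        0 < (g * star g).re ∧ (∃ s : ℚ, (g * star g).re = s ^ 2 ∨ (g * star g).re = 6 * s ^ 2) ∧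
        moebius (rho (-1) 3 (by norm_num) (castQ (-1) 3 g)) p.1 = q.1)) := by
  by_cases h : (∃ k : ℤ, t = 6 * k ^ 2)
  · rw [if_pos h]
    obtain ⟨k, hk⟩ := h
    exact card_specialPoints_add_two_eq_two_mul_card_atkinLehnerQuotientSix_of_sq_mul ht hk
  · rw [if_neg h, add_zero]
    exact card_specialPoints_eq_two_mul_card_atkinLehnerQuotientSix_of_not ht h

end Uniform

/-! ## §2 The closed forms -/

section Kronecker

/-- **THE NUMBER OF POINTS OF `Z(t)` ON `X₆` IN CLOSED FORM**: for every `t > 0`,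
`#(Pt(t)/Γ₆) = (1 − χ₈(d))(1 − (d∕3))·Σ_{c ∣ F, (c,6)=1} h(c²d)`, `F = conductor 0 t`, `d = −4t/F²` — KRY's
`δ(d; 6)·Σ_{c ∣ n, (c,6)=1} h(c²d)` for the point set (3.4.13) (the degree (3.4.4) weights each point by `2/e_x` instead).
[cite: KudlaRapoportYang2006, §3.4 (3.4.4)–(3.4.6) and (3.4.13)] [cite: Eichler1955, Satz 5] [cite: VignerasLNM800, Ch. III §5 Cor. 5.12–5.14] -/
theorem card_specialPoints_eq_kronecker {m : ℕ} (hm : 0 < m) :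
    (Nat.card (Quot (fun p q : {τ : ℂ // 0 < τ.im ∧ ∃ x : ℍ[ℚ,((-1 : ℤ) : ℚ),((3 : ℤ) : ℚ)],
        x ∈ order (-1) 3 ∧ x.re = 0 ∧ (x * star x).re = (m : ℤ) ∧ moebius (rho (-1) 3 (by norm_num) (castQ (-1) 3 x)) τ = τ} ↦
      ∃ v : ℍ[ℚ,((-1 : ℤ) : ℚ),((3 : ℤ) : ℚ)], (v ∈ order (-1) 3 ∨ v - ⟨1/2, 1/2, 1/2, -1/2⟩ ∈ order (-1) 3) ∧
        v * star v = 1 ∧ moebius (rho (-1) 3 (by norm_num) (castQ (-1) 3 v)) p.1 = q.1)) : ℤ) =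
      (1 - ZMod.χ₈ ((((-4 * (m : ℤ) / ((conductor 0 m : ℕ) : ℤ) ^ 2) : ℤ)) : ZMod 8)) * (1 - legendreSym 3 (-4 * (m : ℤ) / ((conductor 0 m : ℕ) : ℤ) ^ 2)) *
        ∑ c ∈ ((conductor 0 m).divisors.filter fun c : ℕ => c.Coprime 6), (BinQF.classNumber (((c : ℕ) : ℤ) ^ 2 * (-4 * (m : ℤ) / ((conductor 0 m : ℕ) : ℤ) ^ 2)) : ℤ) := by
  rw [card_specialPoints_eq_card_unit_classes (by exact_mod_cast hm : (0 : ℤ) < (m : ℤ))]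
  exact card_unit_classes_eq_kronecker_div hm

/-- **`|L(t)/Γ₆| = 2·δΣh(t)`** for every `t > 0` (the `Γ₆ = O₆¹`-classes of special vectors: twice the `O₆^×`-classes,
Lemma 3.4.3 (i) `−x ∉ Γ·x`). [cite: KudlaRapoportYang2006, §3.4 Lemma 3.4.3 and (3.4.13)] [cite: Eichler1955, Satz 5] -/
theorem card_normOne_classes_eq_kronecker {m : ℕ} (hm : 0 < m) :
    (Nat.card (Quot (fun x y : {x : ℤ × ℤ × ℤ // x.1 ^ 2 - 3 * x.2.1 ^ 2 - 3 * x.2.2 ^ 2 = (m : ℤ)} ↦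
      ∃ u : ℍ[ℚ,((-1 : ℤ) : ℚ),((3 : ℤ) : ℚ)], (u ∈ order (-1) 3 ∨ u - ⟨1/2, 1/2, 1/2, -1/2⟩ ∈ order (-1) 3) ∧
        (u * star u).re = 1 ∧ u * ⟨0, x.1.1, x.1.2.1, x.1.2.2⟩ = ⟨0, y.1.1, y.1.2.1, y.1.2.2⟩ * u)) : ℤ) =
      2 * ((1 - ZMod.χ₈ ((((-4 * (m : ℤ) / ((conductor 0 m : ℕ) : ℤ) ^ 2) : ℤ)) : ZMod 8)) * (1 - legendreSym 3 (-4 * (m : ℤ) / ((conductor 0 m : ℕ) : ℤ) ^ 2)) *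
        ∑ c ∈ ((conductor 0 m).divisors.filter fun c : ℕ => c.Coprime 6), (BinQF.classNumber (((c : ℕ) : ℤ) ^ 2 * (-4 * (m : ℤ) / ((conductor 0 m : ℕ) : ℤ) ^ 2)) : ℤ)) := by
  rw [card_normOne_classes_eq_two_mul_card_unit_classes (by exact_mod_cast hm : (0 : ℤ) < (m : ℤ)), Nat.cast_mul,
    Nat.cast_ofNat, card_unit_classes_eq_kronecker_div hm]

open scoped Classical in
/-- **`2·#(Pt(t)/Γ₆^{(2)}) = δΣh(t) + 2·[t ∈ □]`** for every `t > 0`: the number of points of `Z(t)` on `X₆^{(2)} = X₆/ω₂` in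
closed form. [cite: BayerTravesa2007, §2 p. 318 and §7] [cite: Ogg1983RealPoints, §2 (3)–(4)] [cite: KudlaRapoportYang2006, §3.4 (3.4.6) and Remark 3.4.7] -/
theorem two_mul_card_atkinLehnerQuotientTwo_eq_kronecker {m : ℕ} (hm : 0 < m) :
    2 * (Nat.card (Quot (fun p q : {τ : ℂ // 0 < τ.im ∧ ∃ x : ℍ[ℚ,((-1 : ℤ) : ℚ),((3 : ℤ) : ℚ)],
        x ∈ order (-1) 3 ∧ x.re = 0 ∧ (x * star x).re = (m : ℤ) ∧ moebius (rho (-1) 3 (by norm_num) (castQ (-1) 3 x)) τ = τ} ↦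
      ∃ g : ℍ[ℚ,((-1 : ℤ) : ℚ),((3 : ℤ) : ℚ)], g ≠ 0 ∧
        (∀ a : ℍ[ℚ,((-1 : ℤ) : ℚ),((3 : ℤ) : ℚ)], (a ∈ order (-1) 3 ∨ a - ⟨1/2, 1/2, 1/2, -1/2⟩ ∈ order (-1) 3) →
          ∃ b : ℍ[ℚ,((-1 : ℤ) : ℚ),((3 : ℤ) : ℚ)], (b ∈ order (-1) 3 ∨ b - ⟨1/2, 1/2, 1/2, -1/2⟩ ∈ order (-1) 3) ∧
            g * a = b * g) ∧
        0 < (g * star g).re ∧ (∃ s : ℚ, (g * star g).re = s ^ 2 ∨ (g * star g).re = 2 * s ^ 2) ∧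
        moebius (rho (-1) 3 (by norm_num) (castQ (-1) 3 g)) p.1 = q.1)) : ℤ) =
      (1 - ZMod.χ₈ ((((-4 * (m : ℤ) / ((conductor 0 m : ℕ) : ℤ) ^ 2) : ℤ)) : ZMod 8)) * (1 - legendreSym 3 (-4 * (m : ℤ) / ((conductor 0 m : ℕ) : ℤ) ^ 2)) *
        ∑ c ∈ ((conductor 0 m).divisors.filter fun c : ℕ => c.Coprime 6), (BinQF.classNumber (((c : ℕ) : ℤ) ^ 2 * (-4 * (m : ℤ) / ((conductor 0 m : ℕ) : ℤ) ^ 2)) : ℤ) + (if (∃ k : ℤ, (m : ℤ) = k ^ 2) then 2 else 0) := by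
  have hm' : (0 : ℤ) < (m : ℤ) := by exact_mod_cast hm
  have h := card_specialPoints_add_ite_eq_two_mul_card_atkinLehnerQuotientTwo hm'
  rw [← card_specialPoints_eq_kronecker hm]
  by_cases hs : (∃ k : ℤ, (m : ℤ) = k ^ 2)
  · rw [if_pos hs] at h ⊢
    omega
  · rw [if_neg hs] at h ⊢
    omega

open scoped Classical in
/-- **`2·#(Pt(t)/Γ₆^{(3)}) = δΣh(t) + 2·[t ∈ 3□]`** for every `t > 0` (points of `Z(t)` on `X₆^{(3)} = X₆/ω₃`).
[cite: BayerTravesa2007, §2 p. 318 and §7] [cite: Ogg1983RealPoints, §2 (3)–(4)] [cite: KudlaRapoportYang2006, §3.4 (3.4.6) and Remark 3.4.7] -/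
theorem two_mul_card_atkinLehnerQuotientThree_eq_kronecker {m : ℕ} (hm : 0 < m) :
    2 * (Nat.card (Quot (fun p q : {τ : ℂ // 0 < τ.im ∧ ∃ x : ℍ[ℚ,((-1 : ℤ) : ℚ),((3 : ℤ) : ℚ)],
        x ∈ order (-1) 3 ∧ x.re = 0 ∧ (x * star x).re = (m : ℤ) ∧ moebius (rho (-1) 3 (by norm_num) (castQ (-1) 3 x)) τ = τ} ↦
      ∃ g : ℍ[ℚ,((-1 : ℤ) : ℚ),((3 : ℤ) : ℚ)], g ≠ 0 ∧
        (∀ a : ℍ[ℚ,((-1 : ℤ) : ℚ),((3 : ℤ) : ℚ)], (a ∈ order (-1) 3 ∨ a - ⟨1/2, 1/2, 1/2, -1/2⟩ ∈ order (-1) 3) →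
          ∃ b : ℍ[ℚ,((-1 : ℤ) : ℚ),((3 : ℤ) : ℚ)], (b ∈ order (-1) 3 ∨ b - ⟨1/2, 1/2, 1/2, -1/2⟩ ∈ order (-1) 3) ∧
            g * a = b * g) ∧
        0 < (g * star g).re ∧ (∃ s : ℚ, (g * star g).re = s ^ 2 ∨ (g * star g).re = 3 * s ^ 2) ∧
        moebius (rho (-1) 3 (by norm_num) (castQ (-1) 3 g)) p.1 = q.1)) : ℤ) =
      (1 - ZMod.χ₈ ((((-4 * (m : ℤ) / ((conductor 0 m : ℕ) : ℤ) ^ 2) : ℤ)) : ZMod 8)) * (1 - legendreSym 3 (-4 * (m : ℤ) / ((conductor 0 m : ℕ) : ℤ) ^ 2)) *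
        ∑ c ∈ ((conductor 0 m).divisors.filter fun c : ℕ => c.Coprime 6), (BinQF.classNumber (((c : ℕ) : ℤ) ^ 2 * (-4 * (m : ℤ) / ((conductor 0 m : ℕ) : ℤ) ^ 2)) : ℤ) + (if (∃ k : ℤ, (m : ℤ) = 3 * k ^ 2) then 2 else 0) := by
  have hm' : (0 : ℤ) < (m : ℤ) := by exact_mod_cast hm
  have h := card_specialPoints_add_ite_eq_two_mul_card_atkinLehnerQuotientThree hm'
  rw [← card_specialPoints_eq_kronecker hm]
  by_cases hs : (∃ k : ℤ, (m : ℤ) = 3 * k ^ 2)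
  · rw [if_pos hs] at h ⊢
    omega
  · rw [if_neg hs] at h ⊢
    omega

open scoped Classical in
/-- **`2·#(Pt(t)/Γ₆^{(6)}) = δΣh(t) + 2·[t ∈ 6□]`** for every `t > 0` (points of `Z(t)` on `X₆^{(6)} = X₆/ω₆`).
[cite: BayerTravesa2007, §2 p. 318 and §7] [cite: Ogg1983RealPoints, §2 (3)–(4)] [cite: KudlaRapoportYang2006, §3.4 (3.4.6) and Remark 3.4.7] -/
theorem two_mul_card_atkinLehnerQuotientSix_eq_kronecker {m : ℕ} (hm : 0 < m) :
    2 * (Nat.card (Quot (fun p q : {τ : ℂ // 0 < τ.im ∧ ∃ x : ℍ[ℚ,((-1 : ℤ) : ℚ),((3 : ℤ) : ℚ)],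
        x ∈ order (-1) 3 ∧ x.re = 0 ∧ (x * star x).re = (m : ℤ) ∧ moebius (rho (-1) 3 (by norm_num) (castQ (-1) 3 x)) τ = τ} ↦
      ∃ g : ℍ[ℚ,((-1 : ℤ) : ℚ),((3 : ℤ) : ℚ)], g ≠ 0 ∧
        (∀ a : ℍ[ℚ,((-1 : ℤ) : ℚ),((3 : ℤ) : ℚ)], (a ∈ order (-1) 3 ∨ a - ⟨1/2, 1/2, 1/2, -1/2⟩ ∈ order (-1) 3) →
          ∃ b : ℍ[ℚ,((-1 : ℤ) : ℚ),((3 : ℤ) : ℚ)], (b ∈ order (-1) 3 ∨ b - ⟨1/2, 1/2, 1/2, -1/2⟩ ∈ order (-1) 3) ∧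
            g * a = b * g) ∧
        0 < (g * star g).re ∧ (∃ s : ℚ, (g * star g).re = s ^ 2 ∨ (g * star g).re = 6 * s ^ 2) ∧
        moebius (rho (-1) 3 (by norm_num) (castQ (-1) 3 g)) p.1 = q.1)) : ℤ) =
      (1 - ZMod.χ₈ ((((-4 * (m : ℤ) / ((conductor 0 m : ℕ) : ℤ) ^ 2) : ℤ)) : ZMod 8)) * (1 - legendreSym 3 (-4 * (m : ℤ) / ((conductor 0 m : ℕ) : ℤ) ^ 2)) *
        ∑ c ∈ ((conductor 0 m).divisors.filter fun c : ℕ => c.Coprime 6), (BinQF.classNumber (((c : ℕ) : ℤ) ^ 2 * (-4 * (m : ℤ) / ((conductor 0 m : ℕ) : ℤ) ^ 2)) : ℤ) + (if (∃ k : ℤ, (m : ℤ) = 6 * k ^ 2) then 2 else 0) := by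
  have hm' : (0 : ℤ) < (m : ℤ) := by exact_mod_cast hm
  have h := card_specialPoints_add_ite_eq_two_mul_card_atkinLehnerQuotientSix hm'
  rw [← card_specialPoints_eq_kronecker hm]
  by_cases hs : (∃ k : ℤ, (m : ℤ) = 6 * k ^ 2)
  · rw [if_pos hs] at h ⊢
    omega
  · rw [if_neg hs] at h ⊢
    omega

open scoped Classical in
/-- **`4·#(Pt(t)/Γ₆⁺) = δΣh(t) + ε(t)`** for every `t > 0`: THE NUMBER OF POINTS OF `Z(t)` ON `X₆⁺ = X₆/W` IN CLOSED FORM.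
[cite: KudlaRapoportYang2006, §3.4 (3.4.6) and Remark 3.4.7] [cite: BayerTravesa2007, §2 p. 318 and §7] [cite: Ogg1983RealPoints, §2 (2)–(4)] -/
theorem four_mul_card_specialPointsPlus_eq_kronecker {m : ℕ} (hm : 0 < m) :
    4 * (Nat.card (Quot (fun p q : {τ : ℂ // 0 < τ.im ∧ ∃ x : ℍ[ℚ,((-1 : ℤ) : ℚ),((3 : ℤ) : ℚ)],
        x ∈ order (-1) 3 ∧ x.re = 0 ∧ (x * star x).re = (m : ℤ) ∧ moebius (rho (-1) 3 (by norm_num) (castQ (-1) 3 x)) τ = τ} ↦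
      ∃ g : ℍ[ℚ,((-1 : ℤ) : ℚ),((3 : ℤ) : ℚ)], g ≠ 0 ∧
        (∀ a : ℍ[ℚ,((-1 : ℤ) : ℚ),((3 : ℤ) : ℚ)], (a ∈ order (-1) 3 ∨ a - ⟨1/2, 1/2, 1/2, -1/2⟩ ∈ order (-1) 3) →
          ∃ b : ℍ[ℚ,((-1 : ℤ) : ℚ),((3 : ℤ) : ℚ)], (b ∈ order (-1) 3 ∨ b - ⟨1/2, 1/2, 1/2, -1/2⟩ ∈ order (-1) 3) ∧
            g * a = b * g) ∧
        0 < (g * star g).re ∧ moebius (rho (-1) 3 (by norm_num) (castQ (-1) 3 g)) p.1 = q.1)) : ℤ) =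
      (1 - ZMod.χ₈ ((((-4 * (m : ℤ) / ((conductor 0 m : ℕ) : ℤ) ^ 2) : ℤ)) : ZMod 8)) * (1 - legendreSym 3 (-4 * (m : ℤ) / ((conductor 0 m : ℕ) : ℤ) ^ 2)) *
        ∑ c ∈ ((conductor 0 m).divisors.filter fun c : ℕ => c.Coprime 6), (BinQF.classNumber (((c : ℕ) : ℤ) ^ 2 * (-4 * (m : ℤ) / ((conductor 0 m : ℕ) : ℤ) ^ 2)) : ℤ) + (if ((∃ k : ℤ, (m : ℤ) = k ^ 2) ∨ (∃ k : ℤ, (m : ℤ) = 3 * k ^ 2) ∨ (∃ k : ℤ, (m : ℤ) = 6 * k ^ 2)) then 2 else 0) := by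
  have hm' : (0 : ℤ) < (m : ℤ) := by exact_mod_cast hm
  have h := card_specialPoints_add_ite_eq_four_mul_card_specialPointsPlus hm'
  rw [← card_specialPoints_eq_kronecker hm]
  by_cases hs : ((∃ k : ℤ, (m : ℤ) = k ^ 2) ∨ (∃ k : ℤ, (m : ℤ) = 3 * k ^ 2) ∨ (∃ k : ℤ, (m : ℤ) = 6 * k ^ 2))
  · rw [if_pos hs] at h ⊢
    omega
  · rw [if_neg hs] at h ⊢
    omega

open scoped Classical in
/-- **`4·|L(t)/N(O₆)| = δΣh(t) + ε(t)`** for every `t > 0`: the number of `W`-INVARIANT special cycles of index `t` — the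
special vectors of norm `t` up to the whole normaliser `N(O₆) = ℚ^×O₆^{±1}{1, w₂, w₃, w₆}` — in closed form (against the
ten values of `…NormaliserClassCount` found by exhaustion). [cite: KudlaRapoportYang2006, §3.4 (3.4.6), (3.4.13) and Remark 3.4.7] [cite: VignerasLNM800, Ch. IV §3 B] [cite: Eichler1955, Satz 5] -/
theorem four_mul_card_normaliser_classes_eq_kronecker {m : ℕ} (hm : 0 < m) :
    4 * (Nat.card (Quot (fun x y : {x : ℤ × ℤ × ℤ // x.1 ^ 2 - 3 * x.2.1 ^ 2 - 3 * x.2.2 ^ 2 = (m : ℤ)} ↦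
      ∃ g : ℍ[ℚ,((-1 : ℤ) : ℚ),((3 : ℤ) : ℚ)], g ≠ 0 ∧
        (∀ a : ℍ[ℚ,((-1 : ℤ) : ℚ),((3 : ℤ) : ℚ)], (a ∈ order (-1) 3 ∨ a - ⟨1/2, 1/2, 1/2, -1/2⟩ ∈ order (-1) 3) →
          ∃ b : ℍ[ℚ,((-1 : ℤ) : ℚ),((3 : ℤ) : ℚ)], (b ∈ order (-1) 3 ∨ b - ⟨1/2, 1/2, 1/2, -1/2⟩ ∈ order (-1) 3) ∧
            g * a = b * g) ∧
        g * ⟨0, x.1.1, x.1.2.1, x.1.2.2⟩ = ⟨0, y.1.1, y.1.2.1, y.1.2.2⟩ * g)) : ℤ) =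
      (1 - ZMod.χ₈ ((((-4 * (m : ℤ) / ((conductor 0 m : ℕ) : ℤ) ^ 2) : ℤ)) : ZMod 8)) * (1 - legendreSym 3 (-4 * (m : ℤ) / ((conductor 0 m : ℕ) : ℤ) ^ 2)) *
        ∑ c ∈ ((conductor 0 m).divisors.filter fun c : ℕ => c.Coprime 6), (BinQF.classNumber (((c : ℕ) : ℤ) ^ 2 * (-4 * (m : ℤ) / ((conductor 0 m : ℕ) : ℤ) ^ 2)) : ℤ) + (if ((∃ k : ℤ, (m : ℤ) = k ^ 2) ∨ (∃ k : ℤ, (m : ℤ) = 3 * k ^ 2) ∨ (∃ k : ℤ, (m : ℤ) = 6 * k ^ 2)) then 2 else 0) := by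
  have hm' : (0 : ℤ) < (m : ℤ) := by exact_mod_cast hm
  have h := card_unit_classes_add_ite_eq_four_mul_card_normaliser_classes hm'
  rw [← card_unit_classes_eq_kronecker_div hm]
  by_cases hs : ((∃ k : ℤ, (m : ℤ) = k ^ 2) ∨ (∃ k : ℤ, (m : ℤ) = 3 * k ^ 2) ∨ (∃ k : ℤ, (m : ℤ) = 6 * k ^ 2))
  · rw [if_pos hs] at h ⊢
    omega
  · rw [if_neg hs] at h ⊢
    omega

end Kronecker

/-! ## §3 Congruences for the class-number expression -/

section Congruences

open scoped Classical in
/-- **`4 ∣ δΣh(t) + ε(t)` for every `t > 0`**: the class-number expression `(1 − χ₈(d))(1 − (d∕3))·Σ_{c ∣ F, (c,6)=1} h(c²d)`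
is `≡ −ε(t) ≡ ε(t) (mod 4)` — a congruence read off the free action of `W` on the points of `Z(t)` away from
`Z(1) ∪ Z(3) ∪ Z(6)`. [cite: KudlaRapoportYang2006, §3.4 (3.4.6) and Remark 3.4.7] [cite: Ogg1983RealPoints, §2 (2)–(4)] -/
theorem four_dvd_kronecker_add_ite {m : ℕ} (hm : 0 < m) :
    (4 : ℤ) ∣ (1 - ZMod.χ₈ ((((-4 * (m : ℤ) / ((conductor 0 m : ℕ) : ℤ) ^ 2) : ℤ)) : ZMod 8)) * (1 - legendreSym 3 (-4 * (m : ℤ) / ((conductor 0 m : ℕ) : ℤ) ^ 2)) *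
        ∑ c ∈ ((conductor 0 m).divisors.filter fun c : ℕ => c.Coprime 6), (BinQF.classNumber (((c : ℕ) : ℤ) ^ 2 * (-4 * (m : ℤ) / ((conductor 0 m : ℕ) : ℤ) ^ 2)) : ℤ) + (if ((∃ k : ℤ, (m : ℤ) = k ^ 2) ∨ (∃ k : ℤ, (m : ℤ) = 3 * k ^ 2) ∨ (∃ k : ℤ, (m : ℤ) = 6 * k ^ 2)) then 2 else 0) := by
  rw [← four_mul_card_normaliser_classes_eq_kronecker hm]
  exact dvd_mul_right 4 _

/-- **`2 ∣ δΣh(t)` for every `t > 0`** (`= |L(t)/O₆^×|`, which is even: `x ↦ −x` has no fixed class,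
`two_dvd_card_unit_classes`). [cite: KudlaRapoportYang2006, §3.4 Lemma 3.4.3 and (3.4.6)] -/
theorem two_dvd_kronecker {m : ℕ} (hm : 0 < m) :
    (2 : ℤ) ∣ (1 - ZMod.χ₈ ((((-4 * (m : ℤ) / ((conductor 0 m : ℕ) : ℤ) ^ 2) : ℤ)) : ZMod 8)) * (1 - legendreSym 3 (-4 * (m : ℤ) / ((conductor 0 m : ℕ) : ℤ) ^ 2)) *
        ∑ c ∈ ((conductor 0 m).divisors.filter fun c : ℕ => c.Coprime 6), (BinQF.classNumber (((c : ℕ) : ℤ) ^ 2 * (-4 * (m : ℤ) / ((conductor 0 m : ℕ) : ℤ) ^ 2)) : ℤ) := by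
  rw [← card_unit_classes_eq_kronecker_div hm]
  obtain ⟨c, hc⟩ := two_dvd_card_unit_classes (by exact_mod_cast hm : (0 : ℤ) < (m : ℤ))
  exact ⟨(c : ℤ), by rw [hc, Nat.cast_mul, Nat.cast_ofNat]⟩

open scoped Classical in
/-- **`|L(t)/O₆^×| ≡ ε(t) (mod 4)`** for every `t > 0`: `4 ∣ |L(t)/O₆^×|` exactly when `t ∉ □ ∪ 3□ ∪ 6□`, otherwise
`|L(t)/O₆^×| ≡ 2 (mod 4)`. [cite: KudlaRapoportYang2006, §3.4 Remark 3.4.7 and (3.4.13)] [cite: Ogg1983RealPoints, §2 (2)–(4)] -/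
theorem card_unit_classes_emod_four {t : ℤ} (ht : 0 < t) :
    (Nat.card (Quot (fun x y : {x : ℤ × ℤ × ℤ // x.1 ^ 2 - 3 * x.2.1 ^ 2 - 3 * x.2.2 ^ 2 = t} ↦
      ∃ v : ℍ[ℚ,((-1 : ℤ) : ℚ),((3 : ℤ) : ℚ)], (v ∈ order (-1) 3 ∨ v - ⟨1/2, 1/2, 1/2, -1/2⟩ ∈ order (-1) 3) ∧
        ((v * star v).re = 1 ∨ (v * star v).re = -1) ∧
        v * ⟨0, x.1.1, x.1.2.1, x.1.2.2⟩ = ⟨0, y.1.1, y.1.2.1, y.1.2.2⟩ * v)) : ℤ) % 4 = if ((∃ k : ℤ, t = k ^ 2) ∨ (∃ k : ℤ, t = 3 * k ^ 2) ∨ (∃ k : ℤ, t = 6 * k ^ 2)) then 2 else 0 := by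
  have h := card_unit_classes_add_ite_eq_four_mul_card_normaliser_classes ht
  by_cases hs : ((∃ k : ℤ, t = k ^ 2) ∨ (∃ k : ℤ, t = 3 * k ^ 2) ∨ (∃ k : ℤ, t = 6 * k ^ 2))
  · rw [if_pos hs] at h ⊢
    omega
  · rw [if_neg hs] at h ⊢
    omega

end Congruences

/-! ## §4 Values: `Z(30), Z(43), Z(67), Z(100), Z(163)` on `X₆⁺` -/

section Values

/-- `t = 1·k²`, `k ∈ ℤ`, for a numeral `t` is decided by a bounded search over `ℕ`. [folklore] -/
private theorem exists_eq_sq_iff₄₁ (n : ℕ) :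
    (∃ k : ℤ, (n : ℤ) = k ^ 2) ↔ ∃ k : ℕ, k < n + 1 ∧ n = 1 * k ^ 2 := by
  constructor
  · rintro ⟨k, hk⟩
    have h1 : (n : ℤ) = (k.natAbs : ℤ) ^ 2 := by rw [hk, Int.natAbs_sq]
    have h2 : n = k.natAbs ^ 2 := by exact_mod_cast h1
    refine ⟨k.natAbs, Nat.lt_succ_of_le ?_, by rw [one_mul]; exact h2⟩
    rcases Nat.eq_zero_or_pos k.natAbs with h0 | hpos
    · rw [h0]; exact Nat.zero_le _
    · calc k.natAbs ≤ k.natAbs ^ 2 := by nlinarith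
        _ = n := h2.symm
  · rintro ⟨k, -, hk⟩
    exact ⟨k, by rw [hk]; push_cast; ring⟩

/-- `t = 3·k²`, bounded search. [folklore] -/
private theorem exists_eq_three_mul_sq_iff₄₁ (n : ℕ) :
    (∃ k : ℤ, (n : ℤ) = 3 * k ^ 2) ↔ ∃ k : ℕ, k < n + 1 ∧ n = 3 * k ^ 2 := by
  constructor
  · rintro ⟨k, hk⟩
    have h1 : (n : ℤ) = 3 * (k.natAbs : ℤ) ^ 2 := by rw [hk, Int.natAbs_sq]
    have h2 : n = 3 * k.natAbs ^ 2 := by exact_mod_cast h1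
    refine ⟨k.natAbs, Nat.lt_succ_of_le ?_, h2⟩
    rcases Nat.eq_zero_or_pos k.natAbs with h0 | hpos
    · rw [h0]; exact Nat.zero_le _
    · calc k.natAbs ≤ k.natAbs ^ 2 := by nlinarith
        _ ≤ 3 * k.natAbs ^ 2 := Nat.le_mul_of_pos_left _ (by norm_num)
        _ = n := h2.symm
  · rintro ⟨k, -, hk⟩
    exact ⟨k, by rw [hk]; push_cast; ring⟩

/-- `t = 6·k²`, bounded search. [folklore] -/
private theorem exists_eq_six_mul_sq_iff₄₁ (n : ℕ) :
    (∃ k : ℤ, (n : ℤ) = 6 * k ^ 2) ↔ ∃ k : ℕ, k < n + 1 ∧ n = 6 * k ^ 2 := by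
  constructor
  · rintro ⟨k, hk⟩
    have h1 : (n : ℤ) = 6 * (k.natAbs : ℤ) ^ 2 := by rw [hk, Int.natAbs_sq]
    have h2 : n = 6 * k.natAbs ^ 2 := by exact_mod_cast h1
    refine ⟨k.natAbs, Nat.lt_succ_of_le ?_, h2⟩
    rcases Nat.eq_zero_or_pos k.natAbs with h0 | hpos
    · rw [h0]; exact Nat.zero_le _
    · calc k.natAbs ≤ k.natAbs ^ 2 := by nlinarith
        _ ≤ 6 * k.natAbs ^ 2 := Nat.le_mul_of_pos_left _ (by norm_num)
        _ = n := h2.symm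
  · rintro ⟨k, -, hk⟩
    exact ⟨k, by rw [hk]; push_cast; ring⟩

/-- **`|L(30)/N(O₆)| = #(Pt(30)/Γ₆⁺) = 1`** (`δΣh = 4`: `d = −120`, `F = 1`, `δ = 1`, `h(−120) = 4`; `ε = 0`): the four points of `Z(30)` on `X₆` form ONE `W`-orbit. [cite: KudlaRapoportYang2006, §3.4 (3.4.6), (3.4.13) and Remark 3.4.7] -/
theorem card_normaliser_classes_thirty :
    Nat.card (Quot (fun x y : {x : ℤ × ℤ × ℤ // x.1 ^ 2 - 3 * x.2.1 ^ 2 - 3 * x.2.2 ^ 2 = (30 : ℤ)} ↦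
      ∃ g : ℍ[ℚ,((-1 : ℤ) : ℚ),((3 : ℤ) : ℚ)], g ≠ 0 ∧
        (∀ a : ℍ[ℚ,((-1 : ℤ) : ℚ),((3 : ℤ) : ℚ)], (a ∈ order (-1) 3 ∨ a - ⟨1/2, 1/2, 1/2, -1/2⟩ ∈ order (-1) 3) →
          ∃ b : ℍ[ℚ,((-1 : ℤ) : ℚ),((3 : ℤ) : ℚ)], (b ∈ order (-1) 3 ∨ b - ⟨1/2, 1/2, 1/2, -1/2⟩ ∈ order (-1) 3) ∧
            g * a = b * g) ∧
        g * ⟨0, x.1.1, x.1.2.1, x.1.2.2⟩ = ⟨0, y.1.1, y.1.2.1, y.1.2.2⟩ * g)) = 1 ∧ Nat.card (Quot (fun p q : {τ : ℂ // 0 < τ.im ∧ ∃ x : ℍ[ℚ,((-1 : ℤ) : ℚ),((3 : ℤ) : ℚ)],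
        x ∈ order (-1) 3 ∧ x.re = 0 ∧ (x * star x).re = (30 : ℤ) ∧ moebius (rho (-1) 3 (by norm_num) (castQ (-1) 3 x)) τ = τ} ↦
      ∃ g : ℍ[ℚ,((-1 : ℤ) : ℚ),((3 : ℤ) : ℚ)], g ≠ 0 ∧
        (∀ a : ℍ[ℚ,((-1 : ℤ) : ℚ),((3 : ℤ) : ℚ)], (a ∈ order (-1) 3 ∨ a - ⟨1/2, 1/2, 1/2, -1/2⟩ ∈ order (-1) 3) →
          ∃ b : ℍ[ℚ,((-1 : ℤ) : ℚ),((3 : ℤ) : ℚ)], (b ∈ order (-1) 3 ∨ b - ⟨1/2, 1/2, 1/2, -1/2⟩ ∈ order (-1) 3) ∧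
            g * a = b * g) ∧
        0 < (g * star g).re ∧ moebius (rho (-1) 3 (by norm_num) (castQ (-1) 3 g)) p.1 = q.1)) = 1 := by
  have h := four_mul_card_normaliser_classes_eq_kronecker (m := 30) (by norm_num)
  have hP := four_mul_card_specialPointsPlus_eq_kronecker (m := 30) (by norm_num)
  have hv : (1 - ZMod.χ₈ ((((-4 * ((30 : ℕ) : ℤ) / ((conductor 0 30 : ℕ) : ℤ) ^ 2) : ℤ)) : ZMod 8)) * (1 - legendreSym 3 (-4 * ((30 : ℕ) : ℤ) / ((conductor 0 30 : ℕ) : ℤ) ^ 2)) *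
        ∑ c ∈ ((conductor 0 30).divisors.filter fun c : ℕ => c.Coprime 6), (BinQF.classNumber (((c : ℕ) : ℤ) ^ 2 * (-4 * ((30 : ℕ) : ℤ) / ((conductor 0 30 : ℕ) : ℤ) ^ 2)) : ℤ) = 4 := by
    decide +kernel
  have hs : ¬ ((∃ k : ℤ, ((30 : ℕ) : ℤ) = k ^ 2) ∨ (∃ k : ℤ, ((30 : ℕ) : ℤ) = 3 * k ^ 2) ∨ (∃ k : ℤ, ((30 : ℕ) : ℤ) = 6 * k ^ 2)) := by
    rw [exists_eq_sq_iff₄₁, exists_eq_three_mul_sq_iff₄₁, exists_eq_six_mul_sq_iff₄₁]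
    decide +kernel
  rw [if_neg hs, add_zero] at h hP
  rw [hv] at h hP
  have e1 : Nat.card (Quot (fun x y : {x : ℤ × ℤ × ℤ // x.1 ^ 2 - 3 * x.2.1 ^ 2 - 3 * x.2.2 ^ 2 = (30 : ℤ)} ↦
      ∃ g : ℍ[ℚ,((-1 : ℤ) : ℚ),((3 : ℤ) : ℚ)], g ≠ 0 ∧
        (∀ a : ℍ[ℚ,((-1 : ℤ) : ℚ),((3 : ℤ) : ℚ)], (a ∈ order (-1) 3 ∨ a - ⟨1/2, 1/2, 1/2, -1/2⟩ ∈ order (-1) 3) →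
          ∃ b : ℍ[ℚ,((-1 : ℤ) : ℚ),((3 : ℤ) : ℚ)], (b ∈ order (-1) 3 ∨ b - ⟨1/2, 1/2, 1/2, -1/2⟩ ∈ order (-1) 3) ∧
            g * a = b * g) ∧
        g * ⟨0, x.1.1, x.1.2.1, x.1.2.2⟩ = ⟨0, y.1.1, y.1.2.1, y.1.2.2⟩ * g)) = Nat.card (Quot (fun x y : {x : ℤ × ℤ × ℤ // x.1 ^ 2 - 3 * x.2.1 ^ 2 - 3 * x.2.2 ^ 2 = ((30 : ℕ) : ℤ)} ↦
      ∃ g : ℍ[ℚ,((-1 : ℤ) : ℚ),((3 : ℤ) : ℚ)], g ≠ 0 ∧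
        (∀ a : ℍ[ℚ,((-1 : ℤ) : ℚ),((3 : ℤ) : ℚ)], (a ∈ order (-1) 3 ∨ a - ⟨1/2, 1/2, 1/2, -1/2⟩ ∈ order (-1) 3) →
          ∃ b : ℍ[ℚ,((-1 : ℤ) : ℚ),((3 : ℤ) : ℚ)], (b ∈ order (-1) 3 ∨ b - ⟨1/2, 1/2, 1/2, -1/2⟩ ∈ order (-1) 3) ∧
            g * a = b * g) ∧
        g * ⟨0, x.1.1, x.1.2.1, x.1.2.2⟩ = ⟨0, y.1.1, y.1.2.1, y.1.2.2⟩ * g)) := rfl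
  have e2 : Nat.card (Quot (fun p q : {τ : ℂ // 0 < τ.im ∧ ∃ x : ℍ[ℚ,((-1 : ℤ) : ℚ),((3 : ℤ) : ℚ)],
        x ∈ order (-1) 3 ∧ x.re = 0 ∧ (x * star x).re = (30 : ℤ) ∧ moebius (rho (-1) 3 (by norm_num) (castQ (-1) 3 x)) τ = τ} ↦
      ∃ g : ℍ[ℚ,((-1 : ℤ) : ℚ),((3 : ℤ) : ℚ)], g ≠ 0 ∧
        (∀ a : ℍ[ℚ,((-1 : ℤ) : ℚ),((3 : ℤ) : ℚ)], (a ∈ order (-1) 3 ∨ a - ⟨1/2, 1/2, 1/2, -1/2⟩ ∈ order (-1) 3) →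
          ∃ b : ℍ[ℚ,((-1 : ℤ) : ℚ),((3 : ℤ) : ℚ)], (b ∈ order (-1) 3 ∨ b - ⟨1/2, 1/2, 1/2, -1/2⟩ ∈ order (-1) 3) ∧
            g * a = b * g) ∧
        0 < (g * star g).re ∧ moebius (rho (-1) 3 (by norm_num) (castQ (-1) 3 g)) p.1 = q.1)) = Nat.card (Quot (fun p q : {τ : ℂ // 0 < τ.im ∧ ∃ x : ℍ[ℚ,((-1 : ℤ) : ℚ),((3 : ℤ) : ℚ)],
        x ∈ order (-1) 3 ∧ x.re = 0 ∧ (x * star x).re = ((30 : ℕ) : ℤ) ∧ moebius (rho (-1) 3 (by norm_num) (castQ (-1) 3 x)) τ = τ} ↦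
      ∃ g : ℍ[ℚ,((-1 : ℤ) : ℚ),((3 : ℤ) : ℚ)], g ≠ 0 ∧
        (∀ a : ℍ[ℚ,((-1 : ℤ) : ℚ),((3 : ℤ) : ℚ)], (a ∈ order (-1) 3 ∨ a - ⟨1/2, 1/2, 1/2, -1/2⟩ ∈ order (-1) 3) →
          ∃ b : ℍ[ℚ,((-1 : ℤ) : ℚ),((3 : ℤ) : ℚ)], (b ∈ order (-1) 3 ∨ b - ⟨1/2, 1/2, 1/2, -1/2⟩ ∈ order (-1) 3) ∧
            g * a = b * g) ∧
        0 < (g * star g).re ∧ moebius (rho (-1) 3 (by norm_num) (castQ (-1) 3 g)) p.1 = q.1)) := rfl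
  rw [e1, e2]
  constructor <;> omega

/-- **`|L(43)/N(O₆)| = #(Pt(43)/Γ₆⁺) = 1`** (`δΣh = 4`: `d = −43`, `δ = 4`, `h(−43) = 1`; `ε = 0`). [cite: KudlaRapoportYang2006, §3.4 (3.4.6), (3.4.13) and Remark 3.4.7] -/
theorem card_normaliser_classes_fortythree :
    Nat.card (Quot (fun x y : {x : ℤ × ℤ × ℤ // x.1 ^ 2 - 3 * x.2.1 ^ 2 - 3 * x.2.2 ^ 2 = (43 : ℤ)} ↦
      ∃ g : ℍ[ℚ,((-1 : ℤ) : ℚ),((3 : ℤ) : ℚ)], g ≠ 0 ∧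
        (∀ a : ℍ[ℚ,((-1 : ℤ) : ℚ),((3 : ℤ) : ℚ)], (a ∈ order (-1) 3 ∨ a - ⟨1/2, 1/2, 1/2, -1/2⟩ ∈ order (-1) 3) →
          ∃ b : ℍ[ℚ,((-1 : ℤ) : ℚ),((3 : ℤ) : ℚ)], (b ∈ order (-1) 3 ∨ b - ⟨1/2, 1/2, 1/2, -1/2⟩ ∈ order (-1) 3) ∧
            g * a = b * g) ∧
        g * ⟨0, x.1.1, x.1.2.1, x.1.2.2⟩ = ⟨0, y.1.1, y.1.2.1, y.1.2.2⟩ * g)) = 1 ∧ Nat.card (Quot (fun p q : {τ : ℂ // 0 < τ.im ∧ ∃ x : ℍ[ℚ,((-1 : ℤ) : ℚ),((3 : ℤ) : ℚ)],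
        x ∈ order (-1) 3 ∧ x.re = 0 ∧ (x * star x).re = (43 : ℤ) ∧ moebius (rho (-1) 3 (by norm_num) (castQ (-1) 3 x)) τ = τ} ↦
      ∃ g : ℍ[ℚ,((-1 : ℤ) : ℚ),((3 : ℤ) : ℚ)], g ≠ 0 ∧
        (∀ a : ℍ[ℚ,((-1 : ℤ) : ℚ),((3 : ℤ) : ℚ)], (a ∈ order (-1) 3 ∨ a - ⟨1/2, 1/2, 1/2, -1/2⟩ ∈ order (-1) 3) →
          ∃ b : ℍ[ℚ,((-1 : ℤ) : ℚ),((3 : ℤ) : ℚ)], (b ∈ order (-1) 3 ∨ b - ⟨1/2, 1/2, 1/2, -1/2⟩ ∈ order (-1) 3) ∧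
            g * a = b * g) ∧
        0 < (g * star g).re ∧ moebius (rho (-1) 3 (by norm_num) (castQ (-1) 3 g)) p.1 = q.1)) = 1 := by
  have h := four_mul_card_normaliser_classes_eq_kronecker (m := 43) (by norm_num)
  have hP := four_mul_card_specialPointsPlus_eq_kronecker (m := 43) (by norm_num)
  have hv : (1 - ZMod.χ₈ ((((-4 * ((43 : ℕ) : ℤ) / ((conductor 0 43 : ℕ) : ℤ) ^ 2) : ℤ)) : ZMod 8)) * (1 - legendreSym 3 (-4 * ((43 : ℕ) : ℤ) / ((conductor 0 43 : ℕ) : ℤ) ^ 2)) *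
        ∑ c ∈ ((conductor 0 43).divisors.filter fun c : ℕ => c.Coprime 6), (BinQF.classNumber (((c : ℕ) : ℤ) ^ 2 * (-4 * ((43 : ℕ) : ℤ) / ((conductor 0 43 : ℕ) : ℤ) ^ 2)) : ℤ) = 4 := by
    decide +kernel
  have hs : ¬ ((∃ k : ℤ, ((43 : ℕ) : ℤ) = k ^ 2) ∨ (∃ k : ℤ, ((43 : ℕ) : ℤ) = 3 * k ^ 2) ∨ (∃ k : ℤ, ((43 : ℕ) : ℤ) = 6 * k ^ 2)) := by
    rw [exists_eq_sq_iff₄₁, exists_eq_three_mul_sq_iff₄₁, exists_eq_six_mul_sq_iff₄₁]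
    decide +kernel
  rw [if_neg hs, add_zero] at h hP
  rw [hv] at h hP
  have e1 : Nat.card (Quot (fun x y : {x : ℤ × ℤ × ℤ // x.1 ^ 2 - 3 * x.2.1 ^ 2 - 3 * x.2.2 ^ 2 = (43 : ℤ)} ↦
      ∃ g : ℍ[ℚ,((-1 : ℤ) : ℚ),((3 : ℤ) : ℚ)], g ≠ 0 ∧
        (∀ a : ℍ[ℚ,((-1 : ℤ) : ℚ),((3 : ℤ) : ℚ)], (a ∈ order (-1) 3 ∨ a - ⟨1/2, 1/2, 1/2, -1/2⟩ ∈ order (-1) 3) →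
          ∃ b : ℍ[ℚ,((-1 : ℤ) : ℚ),((3 : ℤ) : ℚ)], (b ∈ order (-1) 3 ∨ b - ⟨1/2, 1/2, 1/2, -1/2⟩ ∈ order (-1) 3) ∧
            g * a = b * g) ∧
        g * ⟨0, x.1.1, x.1.2.1, x.1.2.2⟩ = ⟨0, y.1.1, y.1.2.1, y.1.2.2⟩ * g)) = Nat.card (Quot (fun x y : {x : ℤ × ℤ × ℤ // x.1 ^ 2 - 3 * x.2.1 ^ 2 - 3 * x.2.2 ^ 2 = ((43 : ℕ) : ℤ)} ↦
      ∃ g : ℍ[ℚ,((-1 : ℤ) : ℚ),((3 : ℤ) : ℚ)], g ≠ 0 ∧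
        (∀ a : ℍ[ℚ,((-1 : ℤ) : ℚ),((3 : ℤ) : ℚ)], (a ∈ order (-1) 3 ∨ a - ⟨1/2, 1/2, 1/2, -1/2⟩ ∈ order (-1) 3) →
          ∃ b : ℍ[ℚ,((-1 : ℤ) : ℚ),((3 : ℤ) : ℚ)], (b ∈ order (-1) 3 ∨ b - ⟨1/2, 1/2, 1/2, -1/2⟩ ∈ order (-1) 3) ∧
            g * a = b * g) ∧
        g * ⟨0, x.1.1, x.1.2.1, x.1.2.2⟩ = ⟨0, y.1.1, y.1.2.1, y.1.2.2⟩ * g)) := rfl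
  have e2 : Nat.card (Quot (fun p q : {τ : ℂ // 0 < τ.im ∧ ∃ x : ℍ[ℚ,((-1 : ℤ) : ℚ),((3 : ℤ) : ℚ)],
        x ∈ order (-1) 3 ∧ x.re = 0 ∧ (x * star x).re = (43 : ℤ) ∧ moebius (rho (-1) 3 (by norm_num) (castQ (-1) 3 x)) τ = τ} ↦
      ∃ g : ℍ[ℚ,((-1 : ℤ) : ℚ),((3 : ℤ) : ℚ)], g ≠ 0 ∧
        (∀ a : ℍ[ℚ,((-1 : ℤ) : ℚ),((3 : ℤ) : ℚ)], (a ∈ order (-1) 3 ∨ a - ⟨1/2, 1/2, 1/2, -1/2⟩ ∈ order (-1) 3) →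
          ∃ b : ℍ[ℚ,((-1 : ℤ) : ℚ),((3 : ℤ) : ℚ)], (b ∈ order (-1) 3 ∨ b - ⟨1/2, 1/2, 1/2, -1/2⟩ ∈ order (-1) 3) ∧
            g * a = b * g) ∧
        0 < (g * star g).re ∧ moebius (rho (-1) 3 (by norm_num) (castQ (-1) 3 g)) p.1 = q.1)) = Nat.card (Quot (fun p q : {τ : ℂ // 0 < τ.im ∧ ∃ x : ℍ[ℚ,((-1 : ℤ) : ℚ),((3 : ℤ) : ℚ)],
        x ∈ order (-1) 3 ∧ x.re = 0 ∧ (x * star x).re = ((43 : ℕ) : ℤ) ∧ moebius (rho (-1) 3 (by norm_num) (castQ (-1) 3 x)) τ = τ} ↦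
      ∃ g : ℍ[ℚ,((-1 : ℤ) : ℚ),((3 : ℤ) : ℚ)], g ≠ 0 ∧
        (∀ a : ℍ[ℚ,((-1 : ℤ) : ℚ),((3 : ℤ) : ℚ)], (a ∈ order (-1) 3 ∨ a - ⟨1/2, 1/2, 1/2, -1/2⟩ ∈ order (-1) 3) →
          ∃ b : ℍ[ℚ,((-1 : ℤ) : ℚ),((3 : ℤ) : ℚ)], (b ∈ order (-1) 3 ∨ b - ⟨1/2, 1/2, 1/2, -1/2⟩ ∈ order (-1) 3) ∧
            g * a = b * g) ∧
        0 < (g * star g).re ∧ moebius (rho (-1) 3 (by norm_num) (castQ (-1) 3 g)) p.1 = q.1)) := rfl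
  rw [e1, e2]
  constructor <;> omega

/-- **`|L(67)/N(O₆)| = #(Pt(67)/Γ₆⁺) = 1`** (`δΣh = 4`: `d = −67`, `F = 2`, `δ = 4`, `h(−67) = 1`; `ε = 0`): class number one, one point on `X₆⁺`. [cite: KudlaRapoportYang2006, §3.4 (3.4.6), (3.4.13) and Remark 3.4.7] -/
theorem card_normaliser_classes_sixtyseven :
    Nat.card (Quot (fun x y : {x : ℤ × ℤ × ℤ // x.1 ^ 2 - 3 * x.2.1 ^ 2 - 3 * x.2.2 ^ 2 = (67 : ℤ)} ↦
      ∃ g : ℍ[ℚ,((-1 : ℤ) : ℚ),((3 : ℤ) : ℚ)], g ≠ 0 ∧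
        (∀ a : ℍ[ℚ,((-1 : ℤ) : ℚ),((3 : ℤ) : ℚ)], (a ∈ order (-1) 3 ∨ a - ⟨1/2, 1/2, 1/2, -1/2⟩ ∈ order (-1) 3) →
          ∃ b : ℍ[ℚ,((-1 : ℤ) : ℚ),((3 : ℤ) : ℚ)], (b ∈ order (-1) 3 ∨ b - ⟨1/2, 1/2, 1/2, -1/2⟩ ∈ order (-1) 3) ∧
            g * a = b * g) ∧
        g * ⟨0, x.1.1, x.1.2.1, x.1.2.2⟩ = ⟨0, y.1.1, y.1.2.1, y.1.2.2⟩ * g)) = 1 ∧ Nat.card (Quot (fun p q : {τ : ℂ // 0 < τ.im ∧ ∃ x : ℍ[ℚ,((-1 : ℤ) : ℚ),((3 : ℤ) : ℚ)],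
        x ∈ order (-1) 3 ∧ x.re = 0 ∧ (x * star x).re = (67 : ℤ) ∧ moebius (rho (-1) 3 (by norm_num) (castQ (-1) 3 x)) τ = τ} ↦
      ∃ g : ℍ[ℚ,((-1 : ℤ) : ℚ),((3 : ℤ) : ℚ)], g ≠ 0 ∧
        (∀ a : ℍ[ℚ,((-1 : ℤ) : ℚ),((3 : ℤ) : ℚ)], (a ∈ order (-1) 3 ∨ a - ⟨1/2, 1/2, 1/2, -1/2⟩ ∈ order (-1) 3) →
          ∃ b : ℍ[ℚ,((-1 : ℤ) : ℚ),((3 : ℤ) : ℚ)], (b ∈ order (-1) 3 ∨ b - ⟨1/2, 1/2, 1/2, -1/2⟩ ∈ order (-1) 3) ∧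
            g * a = b * g) ∧
        0 < (g * star g).re ∧ moebius (rho (-1) 3 (by norm_num) (castQ (-1) 3 g)) p.1 = q.1)) = 1 := by
  have h := four_mul_card_normaliser_classes_eq_kronecker (m := 67) (by norm_num)
  have hP := four_mul_card_specialPointsPlus_eq_kronecker (m := 67) (by norm_num)
  have hv : (1 - ZMod.χ₈ ((((-4 * ((67 : ℕ) : ℤ) / ((conductor 0 67 : ℕ) : ℤ) ^ 2) : ℤ)) : ZMod 8)) * (1 - legendreSym 3 (-4 * ((67 : ℕ) : ℤ) / ((conductor 0 67 : ℕ) : ℤ) ^ 2)) *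
        ∑ c ∈ ((conductor 0 67).divisors.filter fun c : ℕ => c.Coprime 6), (BinQF.classNumber (((c : ℕ) : ℤ) ^ 2 * (-4 * ((67 : ℕ) : ℤ) / ((conductor 0 67 : ℕ) : ℤ) ^ 2)) : ℤ) = 4 := by
    decide +kernel
  have hs : ¬ ((∃ k : ℤ, ((67 : ℕ) : ℤ) = k ^ 2) ∨ (∃ k : ℤ, ((67 : ℕ) : ℤ) = 3 * k ^ 2) ∨ (∃ k : ℤ, ((67 : ℕ) : ℤ) = 6 * k ^ 2)) := by
    rw [exists_eq_sq_iff₄₁, exists_eq_three_mul_sq_iff₄₁, exists_eq_six_mul_sq_iff₄₁]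
    decide +kernel
  rw [if_neg hs, add_zero] at h hP
  rw [hv] at h hP
  have e1 : Nat.card (Quot (fun x y : {x : ℤ × ℤ × ℤ // x.1 ^ 2 - 3 * x.2.1 ^ 2 - 3 * x.2.2 ^ 2 = (67 : ℤ)} ↦
      ∃ g : ℍ[ℚ,((-1 : ℤ) : ℚ),((3 : ℤ) : ℚ)], g ≠ 0 ∧
        (∀ a : ℍ[ℚ,((-1 : ℤ) : ℚ),((3 : ℤ) : ℚ)], (a ∈ order (-1) 3 ∨ a - ⟨1/2, 1/2, 1/2, -1/2⟩ ∈ order (-1) 3) →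
          ∃ b : ℍ[ℚ,((-1 : ℤ) : ℚ),((3 : ℤ) : ℚ)], (b ∈ order (-1) 3 ∨ b - ⟨1/2, 1/2, 1/2, -1/2⟩ ∈ order (-1) 3) ∧
            g * a = b * g) ∧
        g * ⟨0, x.1.1, x.1.2.1, x.1.2.2⟩ = ⟨0, y.1.1, y.1.2.1, y.1.2.2⟩ * g)) = Nat.card (Quot (fun x y : {x : ℤ × ℤ × ℤ // x.1 ^ 2 - 3 * x.2.1 ^ 2 - 3 * x.2.2 ^ 2 = ((67 : ℕ) : ℤ)} ↦
      ∃ g : ℍ[ℚ,((-1 : ℤ) : ℚ),((3 : ℤ) : ℚ)], g ≠ 0 ∧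
        (∀ a : ℍ[ℚ,((-1 : ℤ) : ℚ),((3 : ℤ) : ℚ)], (a ∈ order (-1) 3 ∨ a - ⟨1/2, 1/2, 1/2, -1/2⟩ ∈ order (-1) 3) →
          ∃ b : ℍ[ℚ,((-1 : ℤ) : ℚ),((3 : ℤ) : ℚ)], (b ∈ order (-1) 3 ∨ b - ⟨1/2, 1/2, 1/2, -1/2⟩ ∈ order (-1) 3) ∧
            g * a = b * g) ∧
        g * ⟨0, x.1.1, x.1.2.1, x.1.2.2⟩ = ⟨0, y.1.1, y.1.2.1, y.1.2.2⟩ * g)) := rfl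
  have e2 : Nat.card (Quot (fun p q : {τ : ℂ // 0 < τ.im ∧ ∃ x : ℍ[ℚ,((-1 : ℤ) : ℚ),((3 : ℤ) : ℚ)],
        x ∈ order (-1) 3 ∧ x.re = 0 ∧ (x * star x).re = (67 : ℤ) ∧ moebius (rho (-1) 3 (by norm_num) (castQ (-1) 3 x)) τ = τ} ↦
      ∃ g : ℍ[ℚ,((-1 : ℤ) : ℚ),((3 : ℤ) : ℚ)], g ≠ 0 ∧
        (∀ a : ℍ[ℚ,((-1 : ℤ) : ℚ),((3 : ℤ) : ℚ)], (a ∈ order (-1) 3 ∨ a - ⟨1/2, 1/2, 1/2, -1/2⟩ ∈ order (-1) 3) →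
          ∃ b : ℍ[ℚ,((-1 : ℤ) : ℚ),((3 : ℤ) : ℚ)], (b ∈ order (-1) 3 ∨ b - ⟨1/2, 1/2, 1/2, -1/2⟩ ∈ order (-1) 3) ∧
            g * a = b * g) ∧
        0 < (g * star g).re ∧ moebius (rho (-1) 3 (by norm_num) (castQ (-1) 3 g)) p.1 = q.1)) = Nat.card (Quot (fun p q : {τ : ℂ // 0 < τ.im ∧ ∃ x : ℍ[ℚ,((-1 : ℤ) : ℚ),((3 : ℤ) : ℚ)],
        x ∈ order (-1) 3 ∧ x.re = 0 ∧ (x * star x).re = ((67 : ℕ) : ℤ) ∧ moebius (rho (-1) 3 (by norm_num) (castQ (-1) 3 x)) τ = τ} ↦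
      ∃ g : ℍ[ℚ,((-1 : ℤ) : ℚ),((3 : ℤ) : ℚ)], g ≠ 0 ∧
        (∀ a : ℍ[ℚ,((-1 : ℤ) : ℚ),((3 : ℤ) : ℚ)], (a ∈ order (-1) 3 ∨ a - ⟨1/2, 1/2, 1/2, -1/2⟩ ∈ order (-1) 3) →
          ∃ b : ℍ[ℚ,((-1 : ℤ) : ℚ),((3 : ℤ) : ℚ)], (b ∈ order (-1) 3 ∨ b - ⟨1/2, 1/2, 1/2, -1/2⟩ ∈ order (-1) 3) ∧
            g * a = b * g) ∧
        0 < (g * star g).re ∧ moebius (rho (-1) 3 (by norm_num) (castQ (-1) 3 g)) p.1 = q.1)) := rfl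
  rw [e1, e2]
  constructor <;> omega

/-- **`|L(100)/N(O₆)| = #(Pt(100)/Γ₆⁺) = 2`** (`δΣh = 6`: `d = −4`, `F = 10`, `δ = 2`, `h(−4) + h(−100) = 3`; `ε = 2` since `100 = 10²`: the two `Z(1)`-points `10·L(1) ⊂ L(100)` are fixed by `ω₂`). [cite: KudlaRapoportYang2006, §3.4 (3.4.6), (3.4.13) and Remark 3.4.7] -/
theorem card_normaliser_classes_hundred :
    Nat.card (Quot (fun x y : {x : ℤ × ℤ × ℤ // x.1 ^ 2 - 3 * x.2.1 ^ 2 - 3 * x.2.2 ^ 2 = (100 : ℤ)} ↦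
      ∃ g : ℍ[ℚ,((-1 : ℤ) : ℚ),((3 : ℤ) : ℚ)], g ≠ 0 ∧
        (∀ a : ℍ[ℚ,((-1 : ℤ) : ℚ),((3 : ℤ) : ℚ)], (a ∈ order (-1) 3 ∨ a - ⟨1/2, 1/2, 1/2, -1/2⟩ ∈ order (-1) 3) →
          ∃ b : ℍ[ℚ,((-1 : ℤ) : ℚ),((3 : ℤ) : ℚ)], (b ∈ order (-1) 3 ∨ b - ⟨1/2, 1/2, 1/2, -1/2⟩ ∈ order (-1) 3) ∧
            g * a = b * g) ∧
        g * ⟨0, x.1.1, x.1.2.1, x.1.2.2⟩ = ⟨0, y.1.1, y.1.2.1, y.1.2.2⟩ * g)) = 2 ∧ Nat.card (Quot (fun p q : {τ : ℂ // 0 < τ.im ∧ ∃ x : ℍ[ℚ,((-1 : ℤ) : ℚ),((3 : ℤ) : ℚ)],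
        x ∈ order (-1) 3 ∧ x.re = 0 ∧ (x * star x).re = (100 : ℤ) ∧ moebius (rho (-1) 3 (by norm_num) (castQ (-1) 3 x)) τ = τ} ↦
      ∃ g : ℍ[ℚ,((-1 : ℤ) : ℚ),((3 : ℤ) : ℚ)], g ≠ 0 ∧
        (∀ a : ℍ[ℚ,((-1 : ℤ) : ℚ),((3 : ℤ) : ℚ)], (a ∈ order (-1) 3 ∨ a - ⟨1/2, 1/2, 1/2, -1/2⟩ ∈ order (-1) 3) →
          ∃ b : ℍ[ℚ,((-1 : ℤ) : ℚ),((3 : ℤ) : ℚ)], (b ∈ order (-1) 3 ∨ b - ⟨1/2, 1/2, 1/2, -1/2⟩ ∈ order (-1) 3) ∧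
            g * a = b * g) ∧
        0 < (g * star g).re ∧ moebius (rho (-1) 3 (by norm_num) (castQ (-1) 3 g)) p.1 = q.1)) = 2 := by
  have h := four_mul_card_normaliser_classes_eq_kronecker (m := 100) (by norm_num)
  have hP := four_mul_card_specialPointsPlus_eq_kronecker (m := 100) (by norm_num)
  have hv : (1 - ZMod.χ₈ ((((-4 * ((100 : ℕ) : ℤ) / ((conductor 0 100 : ℕ) : ℤ) ^ 2) : ℤ)) : ZMod 8)) * (1 - legendreSym 3 (-4 * ((100 : ℕ) : ℤ) / ((conductor 0 100 : ℕ) : ℤ) ^ 2)) *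
        ∑ c ∈ ((conductor 0 100).divisors.filter fun c : ℕ => c.Coprime 6), (BinQF.classNumber (((c : ℕ) : ℤ) ^ 2 * (-4 * ((100 : ℕ) : ℤ) / ((conductor 0 100 : ℕ) : ℤ) ^ 2)) : ℤ) = 6 := by
    decide +kernel
  have hs : ((∃ k : ℤ, ((100 : ℕ) : ℤ) = k ^ 2) ∨ (∃ k : ℤ, ((100 : ℕ) : ℤ) = 3 * k ^ 2) ∨ (∃ k : ℤ, ((100 : ℕ) : ℤ) = 6 * k ^ 2)) := Or.inl ⟨10, by norm_num⟩
  rw [if_pos hs] at h hP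
  rw [hv] at h hP
  have e1 : Nat.card (Quot (fun x y : {x : ℤ × ℤ × ℤ // x.1 ^ 2 - 3 * x.2.1 ^ 2 - 3 * x.2.2 ^ 2 = (100 : ℤ)} ↦
      ∃ g : ℍ[ℚ,((-1 : ℤ) : ℚ),((3 : ℤ) : ℚ)], g ≠ 0 ∧
        (∀ a : ℍ[ℚ,((-1 : ℤ) : ℚ),((3 : ℤ) : ℚ)], (a ∈ order (-1) 3 ∨ a - ⟨1/2, 1/2, 1/2, -1/2⟩ ∈ order (-1) 3) →
          ∃ b : ℍ[ℚ,((-1 : ℤ) : ℚ),((3 : ℤ) : ℚ)], (b ∈ order (-1) 3 ∨ b - ⟨1/2, 1/2, 1/2, -1/2⟩ ∈ order (-1) 3) ∧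
            g * a = b * g) ∧
        g * ⟨0, x.1.1, x.1.2.1, x.1.2.2⟩ = ⟨0, y.1.1, y.1.2.1, y.1.2.2⟩ * g)) = Nat.card (Quot (fun x y : {x : ℤ × ℤ × ℤ // x.1 ^ 2 - 3 * x.2.1 ^ 2 - 3 * x.2.2 ^ 2 = ((100 : ℕ) : ℤ)} ↦
      ∃ g : ℍ[ℚ,((-1 : ℤ) : ℚ),((3 : ℤ) : ℚ)], g ≠ 0 ∧
        (∀ a : ℍ[ℚ,((-1 : ℤ) : ℚ),((3 : ℤ) : ℚ)], (a ∈ order (-1) 3 ∨ a - ⟨1/2, 1/2, 1/2, -1/2⟩ ∈ order (-1) 3) →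
          ∃ b : ℍ[ℚ,((-1 : ℤ) : ℚ),((3 : ℤ) : ℚ)], (b ∈ order (-1) 3 ∨ b - ⟨1/2, 1/2, 1/2, -1/2⟩ ∈ order (-1) 3) ∧
            g * a = b * g) ∧
        g * ⟨0, x.1.1, x.1.2.1, x.1.2.2⟩ = ⟨0, y.1.1, y.1.2.1, y.1.2.2⟩ * g)) := rfl
  have e2 : Nat.card (Quot (fun p q : {τ : ℂ // 0 < τ.im ∧ ∃ x : ℍ[ℚ,((-1 : ℤ) : ℚ),((3 : ℤ) : ℚ)],
        x ∈ order (-1) 3 ∧ x.re = 0 ∧ (x * star x).re = (100 : ℤ) ∧ moebius (rho (-1) 3 (by norm_num) (castQ (-1) 3 x)) τ = τ} ↦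
      ∃ g : ℍ[ℚ,((-1 : ℤ) : ℚ),((3 : ℤ) : ℚ)], g ≠ 0 ∧
        (∀ a : ℍ[ℚ,((-1 : ℤ) : ℚ),((3 : ℤ) : ℚ)], (a ∈ order (-1) 3 ∨ a - ⟨1/2, 1/2, 1/2, -1/2⟩ ∈ order (-1) 3) →
          ∃ b : ℍ[ℚ,((-1 : ℤ) : ℚ),((3 : ℤ) : ℚ)], (b ∈ order (-1) 3 ∨ b - ⟨1/2, 1/2, 1/2, -1/2⟩ ∈ order (-1) 3) ∧
            g * a = b * g) ∧
        0 < (g * star g).re ∧ moebius (rho (-1) 3 (by norm_num) (castQ (-1) 3 g)) p.1 = q.1)) = Nat.card (Quot (fun p q : {τ : ℂ // 0 < τ.im ∧ ∃ x : ℍ[ℚ,((-1 : ℤ) : ℚ),((3 : ℤ) : ℚ)],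
        x ∈ order (-1) 3 ∧ x.re = 0 ∧ (x * star x).re = ((100 : ℕ) : ℤ) ∧ moebius (rho (-1) 3 (by norm_num) (castQ (-1) 3 x)) τ = τ} ↦
      ∃ g : ℍ[ℚ,((-1 : ℤ) : ℚ),((3 : ℤ) : ℚ)], g ≠ 0 ∧
        (∀ a : ℍ[ℚ,((-1 : ℤ) : ℚ),((3 : ℤ) : ℚ)], (a ∈ order (-1) 3 ∨ a - ⟨1/2, 1/2, 1/2, -1/2⟩ ∈ order (-1) 3) →
          ∃ b : ℍ[ℚ,((-1 : ℤ) : ℚ),((3 : ℤ) : ℚ)], (b ∈ order (-1) 3 ∨ b - ⟨1/2, 1/2, 1/2, -1/2⟩ ∈ order (-1) 3) ∧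
            g * a = b * g) ∧
        0 < (g * star g).re ∧ moebius (rho (-1) 3 (by norm_num) (castQ (-1) 3 g)) p.1 = q.1)) := rfl
  rw [e1, e2]
  constructor <;> omega

/-- **`|L(163)/N(O₆)| = #(Pt(163)/Γ₆⁺) = 1`** (`δΣh = 4`: `d = −163`, `F = 2`, `δ = 4`, `h(−163) = 1`; `ε = 0`): the last class-number-one discriminant, one point on `X₆⁺` below four on `X₆`. [cite: KudlaRapoportYang2006, §3.4 (3.4.6), (3.4.13) and Remark 3.4.7] -/
theorem card_normaliser_classes_hundredsixtythree :
    Nat.card (Quot (fun x y : {x : ℤ × ℤ × ℤ // x.1 ^ 2 - 3 * x.2.1 ^ 2 - 3 * x.2.2 ^ 2 = (163 : ℤ)} ↦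
      ∃ g : ℍ[ℚ,((-1 : ℤ) : ℚ),((3 : ℤ) : ℚ)], g ≠ 0 ∧
        (∀ a : ℍ[ℚ,((-1 : ℤ) : ℚ),((3 : ℤ) : ℚ)], (a ∈ order (-1) 3 ∨ a - ⟨1/2, 1/2, 1/2, -1/2⟩ ∈ order (-1) 3) →
          ∃ b : ℍ[ℚ,((-1 : ℤ) : ℚ),((3 : ℤ) : ℚ)], (b ∈ order (-1) 3 ∨ b - ⟨1/2, 1/2, 1/2, -1/2⟩ ∈ order (-1) 3) ∧
            g * a = b * g) ∧
        g * ⟨0, x.1.1, x.1.2.1, x.1.2.2⟩ = ⟨0, y.1.1, y.1.2.1, y.1.2.2⟩ * g)) = 1 ∧ Nat.card (Quot (fun p q : {τ : ℂ // 0 < τ.im ∧ ∃ x : ℍ[ℚ,((-1 : ℤ) : ℚ),((3 : ℤ) : ℚ)],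
        x ∈ order (-1) 3 ∧ x.re = 0 ∧ (x * star x).re = (163 : ℤ) ∧ moebius (rho (-1) 3 (by norm_num) (castQ (-1) 3 x)) τ = τ} ↦
      ∃ g : ℍ[ℚ,((-1 : ℤ) : ℚ),((3 : ℤ) : ℚ)], g ≠ 0 ∧
        (∀ a : ℍ[ℚ,((-1 : ℤ) : ℚ),((3 : ℤ) : ℚ)], (a ∈ order (-1) 3 ∨ a - ⟨1/2, 1/2, 1/2, -1/2⟩ ∈ order (-1) 3) →
          ∃ b : ℍ[ℚ,((-1 : ℤ) : ℚ),((3 : ℤ) : ℚ)], (b ∈ order (-1) 3 ∨ b - ⟨1/2, 1/2, 1/2, -1/2⟩ ∈ order (-1) 3) ∧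
            g * a = b * g) ∧
        0 < (g * star g).re ∧ moebius (rho (-1) 3 (by norm_num) (castQ (-1) 3 g)) p.1 = q.1)) = 1 := by
  have h := four_mul_card_normaliser_classes_eq_kronecker (m := 163) (by norm_num)
  have hP := four_mul_card_specialPointsPlus_eq_kronecker (m := 163) (by norm_num)
  have hv : (1 - ZMod.χ₈ ((((-4 * ((163 : ℕ) : ℤ) / ((conductor 0 163 : ℕ) : ℤ) ^ 2) : ℤ)) : ZMod 8)) * (1 - legendreSym 3 (-4 * ((163 : ℕ) : ℤ) / ((conductor 0 163 : ℕ) : ℤ) ^ 2)) *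
        ∑ c ∈ ((conductor 0 163).divisors.filter fun c : ℕ => c.Coprime 6), (BinQF.classNumber (((c : ℕ) : ℤ) ^ 2 * (-4 * ((163 : ℕ) : ℤ) / ((conductor 0 163 : ℕ) : ℤ) ^ 2)) : ℤ) = 4 := by
    decide +kernel
  have hs : ¬ ((∃ k : ℤ, ((163 : ℕ) : ℤ) = k ^ 2) ∨ (∃ k : ℤ, ((163 : ℕ) : ℤ) = 3 * k ^ 2) ∨ (∃ k : ℤ, ((163 : ℕ) : ℤ) = 6 * k ^ 2)) := by
    rw [exists_eq_sq_iff₄₁, exists_eq_three_mul_sq_iff₄₁, exists_eq_six_mul_sq_iff₄₁]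
    decide +kernel
  rw [if_neg hs, add_zero] at h hP
  rw [hv] at h hP
  have e1 : Nat.card (Quot (fun x y : {x : ℤ × ℤ × ℤ // x.1 ^ 2 - 3 * x.2.1 ^ 2 - 3 * x.2.2 ^ 2 = (163 : ℤ)} ↦
      ∃ g : ℍ[ℚ,((-1 : ℤ) : ℚ),((3 : ℤ) : ℚ)], g ≠ 0 ∧
        (∀ a : ℍ[ℚ,((-1 : ℤ) : ℚ),((3 : ℤ) : ℚ)], (a ∈ order (-1) 3 ∨ a - ⟨1/2, 1/2, 1/2, -1/2⟩ ∈ order (-1) 3) →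
          ∃ b : ℍ[ℚ,((-1 : ℤ) : ℚ),((3 : ℤ) : ℚ)], (b ∈ order (-1) 3 ∨ b - ⟨1/2, 1/2, 1/2, -1/2⟩ ∈ order (-1) 3) ∧
            g * a = b * g) ∧
        g * ⟨0, x.1.1, x.1.2.1, x.1.2.2⟩ = ⟨0, y.1.1, y.1.2.1, y.1.2.2⟩ * g)) = Nat.card (Quot (fun x y : {x : ℤ × ℤ × ℤ // x.1 ^ 2 - 3 * x.2.1 ^ 2 - 3 * x.2.2 ^ 2 = ((163 : ℕ) : ℤ)} ↦
      ∃ g : ℍ[ℚ,((-1 : ℤ) : ℚ),((3 : ℤ) : ℚ)], g ≠ 0 ∧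
        (∀ a : ℍ[ℚ,((-1 : ℤ) : ℚ),((3 : ℤ) : ℚ)], (a ∈ order (-1) 3 ∨ a - ⟨1/2, 1/2, 1/2, -1/2⟩ ∈ order (-1) 3) →
          ∃ b : ℍ[ℚ,((-1 : ℤ) : ℚ),((3 : ℤ) : ℚ)], (b ∈ order (-1) 3 ∨ b - ⟨1/2, 1/2, 1/2, -1/2⟩ ∈ order (-1) 3) ∧
            g * a = b * g) ∧
        g * ⟨0, x.1.1, x.1.2.1, x.1.2.2⟩ = ⟨0, y.1.1, y.1.2.1, y.1.2.2⟩ * g)) := rfl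
  have e2 : Nat.card (Quot (fun p q : {τ : ℂ // 0 < τ.im ∧ ∃ x : ℍ[ℚ,((-1 : ℤ) : ℚ),((3 : ℤ) : ℚ)],
        x ∈ order (-1) 3 ∧ x.re = 0 ∧ (x * star x).re = (163 : ℤ) ∧ moebius (rho (-1) 3 (by norm_num) (castQ (-1) 3 x)) τ = τ} ↦
      ∃ g : ℍ[ℚ,((-1 : ℤ) : ℚ),((3 : ℤ) : ℚ)], g ≠ 0 ∧
        (∀ a : ℍ[ℚ,((-1 : ℤ) : ℚ),((3 : ℤ) : ℚ)], (a ∈ order (-1) 3 ∨ a - ⟨1/2, 1/2, 1/2, -1/2⟩ ∈ order (-1) 3) →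
          ∃ b : ℍ[ℚ,((-1 : ℤ) : ℚ),((3 : ℤ) : ℚ)], (b ∈ order (-1) 3 ∨ b - ⟨1/2, 1/2, 1/2, -1/2⟩ ∈ order (-1) 3) ∧
            g * a = b * g) ∧
        0 < (g * star g).re ∧ moebius (rho (-1) 3 (by norm_num) (castQ (-1) 3 g)) p.1 = q.1)) = Nat.card (Quot (fun p q : {τ : ℂ // 0 < τ.im ∧ ∃ x : ℍ[ℚ,((-1 : ℤ) : ℚ),((3 : ℤ) : ℚ)],
        x ∈ order (-1) 3 ∧ x.re = 0 ∧ (x * star x).re = ((163 : ℕ) : ℤ) ∧ moebius (rho (-1) 3 (by norm_num) (castQ (-1) 3 x)) τ = τ} ↦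
      ∃ g : ℍ[ℚ,((-1 : ℤ) : ℚ),((3 : ℤ) : ℚ)], g ≠ 0 ∧
        (∀ a : ℍ[ℚ,((-1 : ℤ) : ℚ),((3 : ℤ) : ℚ)], (a ∈ order (-1) 3 ∨ a - ⟨1/2, 1/2, 1/2, -1/2⟩ ∈ order (-1) 3) →
          ∃ b : ℍ[ℚ,((-1 : ℤ) : ℚ),((3 : ℤ) : ℚ)], (b ∈ order (-1) 3 ∨ b - ⟨1/2, 1/2, 1/2, -1/2⟩ ∈ order (-1) 3) ∧
            g * a = b * g) ∧
        0 < (g * star g).re ∧ moebius (rho (-1) 3 (by norm_num) (castQ (-1) 3 g)) p.1 = q.1)) := rfl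
  rw [e1, e2]
  constructor <;> omega

end Values

end Literature.Geometry.Kaehler.ComplexTorus.QuaternionType
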